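import Literature.Probability.RandomPlanarGeometry.BrownianLoopPieces
import Literature.Probability.RandomPlanarGeometry.BrownianLoopUnitWeight
import Literature.Probability.RandomPlanarGeometry.BrownianSegmentLaw
import Literature.Probability.RandomPlanarGeometry.BrownianLoopConformalCore
import Literature.Probability.RandomPlanarGeometry.CurveMonotoneReparam
import HarnessLib

/-!
# The marked two-bridge decomposition of the Brownian loop measure, on path space and on curve classes

This module assembles four steps (each with its own section header below): the marked
decomposition of the rooted loop measure into two Brownian bridges (`lintegral_marked_split`),
its transfer to path space `C([0,1], ℂ)` (`lintegral_marked_split_path`), the concatenation of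
the pieces (`unrootCM_concatCM_piecesCM`, `clock_pieces`) and the factorisation of the relevant
functionals through reparametrisation classes (`mkCM_concatCM`, `unrootCM_eq_unrootClass`).
-/

/-!
# The rooted Brownian loop measure with a uniform mark: two bridges through the marked point

Lawler, *Conformally Invariant Processes in the Plane* (2005), §5.2–§5.6: the rooted loop
measure at `z`, `μ(z, z) = ∫₀^∞ μ(z, z; t) dt` with `|μ(z, z; t)| = p_t(z, z) = 1/(2πt)`, and the
Chapman–Kolmogorov relation `μ(z, z; s + s') = ∫ [μ(z, w; s) ⊕ μ(w, z; s')] dA(w)`; hence,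
marking a loop of duration `t` at a uniform time `tu`, `u ∈ [0, 1]`,
`∫₀^∞ (dt/t) ∫₀¹ du μ(z, z; t) = ∫ dA(w) ∫₀^∞ ds ∫₀^∞ ds' (s + s')⁻¹ [μ(z, w; s) ⊕ μ(w, z; s')]`
(`t du dt = ds ds'`). In the tree's realisation of the rooted loop measure as
`(𝟙_{t>0} dt/(2πt²)) ⊗ ℙ` on (duration, Wiener pair) with the loop `γ_{z,t,ω}(r) = z + √t η_ω(r)`
(`BrownianLoopMeasure`: `timeMeasure`, `rootedFun`; the extra factor `t` below turns
`dt/(2πt²)` into `p_t(z,z) dt/t`), this is `lintegral_marked_split`: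

  `∫ (∫₀¹ Φ(piece₁, piece₂) du) · t d(timeMeasure ⊗ ℙ)
     = ∫ dA(w) ∫∫ Φ((bridge_s(z→w), s), (bridge_{s'}(w→z), s')) p_s(w−z) p_{s'}(z−w)/(s+s')
         d(ds ⊗ ℙ) d(ds' ⊗ ℙ)`,

with the pieces in unit-time parametrisation (`fstTime`, `sndTime`) and
`bridge_s(z→w) = bridgeFun z w (s, ·)`. Ingredients: `lintegral_pieces_eq` (the split at a fixed
fraction `u`, `BrownianLoopPieces`), `lintegral_Ioi_unitInterval_split` and
`timeDensity_mul_heat` (`BrownianLoopSplittingCalculus`).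

## References

* G. F. Lawler, *Conformally Invariant Processes in the Plane*, AMS (2005), §5.2, §5.6.
* G. F. Lawler, W. Werner, Probab. Theory Related Fields 128 (2004), §4 (loop soup; rooted vs
  unrooted loops).
-/

noncomputable section

open Set MeasureTheory ProbabilityTheory unitInterval
open scoped unitInterval NNReal ENNReal

namespace Literature.Probability.RandomPlanarGeometry

open Literature.Probability.Process (WienerPair wienerPair)

namespace BrownianLoop

/-! ### Small helpers -/

/-- Measurability of `heat (f a) (g a)` (composition form of `measurable_heat`, stated so that
unification never has to unfold `heat`). [folklore] -/
theorem _root_.Measurable.heat {α : Type*} [MeasurableSpace α] {f : α → ℝ} {g : α → ℂ}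
    (hf : Measurable f) (hg : Measurable g) : Measurable fun a ↦ heat (f a) (g a) := by
  have h := measurable_heat.comp (hf.prodMk hg)
  exact h


/-- Almost every point of `[0,1]` is interior. [folklore] -/
theorem ae_unitInterval_pos_lt_one : ∀ᵐ u : I, 0 < (u : ℝ) ∧ (u : ℝ) < 1 := by
  have h0 : (volume : Measure I) ({0, 1} : Set I) = 0 := (Set.toFinite _).measure_zero _
  rw [ae_iff]
  refine measure_mono_null (fun u hu ↦ ?_) h0
  have hu' : ¬(0 < (u : ℝ) ∧ (u : ℝ) < 1) := hu
  rcases not_and_or.1 hu' with h | h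
  · exact Or.inl (Subtype.ext (le_antisymm (not_lt.1 h) u.2.1))
  · exact Or.inr (Subtype.ext (le_antisymm u.2.2 (not_lt.1 h)))

/-- `u ↦ fstTime u v` is measurable. [folklore] -/
theorem measurable_fstTime_left (v : I) : Measurable fun u : I ↦ fstTime u v :=
  (continuous_induced_dom.mul continuous_const).subtype_mk _ |>.measurable

/-- `u ↦ sndTime u v` is measurable. [folklore] -/
theorem measurable_sndTime_left (v : I) : Measurable fun u : I ↦ sndTime u v := by
  unfold sndTime
  exact unitInterval.continuous_symm.measurable.comp
    ((measurable_fstTime_left (σ v)).comp unitInterval.continuous_symm.measurable)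

variable (z : ℂ)

/-- The two pieces of the rooted loop `γ_{z,q}` split at the fraction `u`, with their durations.
[folklore] -/
def pieces (q : ℝ × WienerPair) (u : I) : ((I → ℂ) × ℝ) × ((I → ℂ) × ℝ) :=
  (((fun v ↦ rootedFun (z, q) (fstTime u v)), q.1 * u),
    ((fun v ↦ rootedFun (z, q) (sndTime u v)), q.1 * (1 - u)))

/-- Joint measurability of the pieces in (duration, sample, fraction). [folklore] -/
theorem measurable_pieces : Measurable fun r : (ℝ × WienerPair) × I ↦ pieces z r.1 r.2 := by
  have hroot : ∀ g : I → I → I, (∀ v, Measurable fun u ↦ g u v) →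
      Measurable fun r : (ℝ × WienerPair) × I ↦ fun v ↦ rootedFun (z, r.1) (g r.2 v) := by
    intro g hg
    refine measurable_pi_lambda _ fun v ↦ ?_
    simp only [rootedFun]
    have h1 : Measurable fun r : (ℝ × WienerPair) × I ↦ unitBridge r.1.2 (g r.2 v) :=
      measurable_uncurry_unitBridge.comp (((hg v).comp measurable_snd).prodMk
        (measurable_snd.comp measurable_fst))
    have h2 : Measurable fun r : (ℝ × WienerPair) × I ↦ (Real.sqrt r.1.1 : ℂ) :=
      Complex.measurable_ofReal.comp ((measurable_fst.comp measurable_fst).sqrt)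
    exact measurable_const.add (h2.mul h1)
  have hu : Measurable fun r : (ℝ × WienerPair) × I ↦ ((r.2 : I) : ℝ) :=
    measurable_subtype_coe.comp measurable_snd
  have ht : Measurable fun r : (ℝ × WienerPair) × I ↦ r.1.1 := measurable_fst.comp measurable_fst
  exact ((hroot _ measurable_fstTime_left).prodMk (ht.mul hu)).prodMk
    ((hroot _ measurable_sndTime_left).prodMk (ht.mul (measurable_const.sub hu)))

/-- The weight of the marked decomposition, `p_s(w − z) p_{s'}(z − w)/(s + s')`, times `Φ` of
the two bridges: the integrand of the right-hand side, jointly measurable. [folklore] -/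
theorem measurable_markedIntegrand {Φ : ((I → ℂ) × ℝ) × ((I → ℂ) × ℝ) → ℝ≥0∞}
    (hΦ : Measurable Φ) :
    Measurable fun r : ℂ × (ℝ × WienerPair) × (ℝ × WienerPair) ↦
      Φ ((bridgeFun z r.1 r.2.1, r.2.1.1), (bridgeFun r.1 z r.2.2, r.2.2.1)) *
        (heat r.2.1.1 (r.1 - z) * heat r.2.2.1 (z - r.1) / ENNReal.ofReal (r.2.1.1 + r.2.2.1)) := by
  have hs : Measurable fun r : ℂ × (ℝ × WienerPair) × (ℝ × WienerPair) ↦ r.2.1.1 :=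
    measurable_fst.comp (measurable_fst.comp measurable_snd)
  have hs' : Measurable fun r : ℂ × (ℝ × WienerPair) × (ℝ × WienerPair) ↦ r.2.2.1 :=
    measurable_fst.comp (measurable_snd.comp measurable_snd)
  have hb1 : Measurable fun r : ℂ × (ℝ × WienerPair) × (ℝ × WienerPair) ↦ bridgeFun z r.1 r.2.1 :=
    measurable_bridgeFun.comp (measurable_const.prodMk (measurable_fst.prodMk
      (measurable_fst.comp measurable_snd)))
  have hb2 : Measurable fun r : ℂ × (ℝ × WienerPair) × (ℝ × WienerPair) ↦ bridgeFun r.1 z r.2.2 :=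
    measurable_bridgeFun.comp (measurable_fst.prodMk (measurable_const.prodMk
      (measurable_snd.comp measurable_snd)))
  have hh1 : Measurable fun r : ℂ × (ℝ × WienerPair) × (ℝ × WienerPair) ↦ heat r.2.1.1 (r.1 - z) :=
    hs.heat (measurable_fst.sub measurable_const)
  have hh2 : Measurable fun r : ℂ × (ℝ × WienerPair) × (ℝ × WienerPair) ↦ heat r.2.2.1 (z - r.1) :=
    hs'.heat (measurable_const.sub measurable_fst)
  have hA : Measurable fun r : ℂ × (ℝ × WienerPair) × (ℝ × WienerPair) ↦
      Φ ((bridgeFun z r.1 r.2.1, r.2.1.1), (bridgeFun r.1 z r.2.2, r.2.2.1)) :=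
    hΦ.comp ((hb1.prodMk hs).prodMk (hb2.prodMk hs'))
  have hW1 : Measurable fun r : ℂ × (ℝ × WienerPair) × (ℝ × WienerPair) ↦
      heat r.2.1.1 (r.1 - z) * heat r.2.2.1 (z - r.1) := hh1.mul hh2
  have hW2 : Measurable fun r : ℂ × (ℝ × WienerPair) × (ℝ × WienerPair) ↦
      ENNReal.ofReal (r.2.1.1 + r.2.2.1) := ENNReal.measurable_ofReal.comp (hs.add hs')
  have hW : Measurable fun r : ℂ × (ℝ × WienerPair) × (ℝ × WienerPair) ↦
      heat r.2.1.1 (r.1 - z) * heat r.2.2.1 (z - r.1) / ENNReal.ofReal (r.2.1.1 + r.2.2.1) :=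
    hW1.div hW2
  exact hA.mul hW

/-! ### The marked decomposition -/

/-- **The rooted Brownian loop measure with a uniform mark decomposes into two Brownian bridges
through the marked point** ([Lawler] §5.2 Chapman–Kolmogorov, integrated against
`p_t(z,z) dt/t · du`): for measurable `Φ ≥ 0` of the two pieces (each with its duration),
`∫ (∫₀¹ Φ(pieces) du) · t d(timeMeasure ⊗ ℙ) = ∫ dA(w) ∫∫ Φ((bridge_s(z→w), s),
(bridge_{s'}(w→z), s')) · p_s(w−z) p_{s'}(z−w)/(s+s') d(ds ⊗ ℙ) d(ds' ⊗ ℙ)`.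
[cite: Lawler2005ConformallyInvariant, §5.2] -/
theorem lintegral_marked_split {Φ : ((I → ℂ) × ℝ) × ((I → ℂ) × ℝ) → ℝ≥0∞} (hΦ : Measurable Φ) :
    ∫⁻ q, (∫⁻ u : I, Φ (pieces z q u)) * ENNReal.ofReal q.1 ∂(timeMeasure.prod wienerPair) =
      ∫⁻ w, ∫⁻ q₁, ∫⁻ q₂, Φ ((bridgeFun z w q₁, q₁.1), (bridgeFun w z q₂, q₂.1)) *
          (heat q₁.1 (w - z) * heat q₂.1 (z - w) / ENNReal.ofReal (q₁.1 + q₂.1))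
        ∂((volume.restrict (Ioi 0)).prod wienerPair)
        ∂((volume.restrict (Ioi 0)).prod wienerPair) := by
  set P : Measure WienerPair := wienerPair with hP
  -- the master integrand of the right-hand side
  set Q : ℂ × (ℝ × WienerPair) × (ℝ × WienerPair) → ℝ≥0∞ := fun r ↦
    Φ ((bridgeFun z r.1 r.2.1, r.2.1.1), (bridgeFun r.1 z r.2.2, r.2.2.1)) *
      (heat r.2.1.1 (r.1 - z) * heat r.2.2.1 (z - r.1) / ENNReal.ofReal (r.2.1.1 + r.2.2.1)) with hQ
  have hQm : Measurable Q := measurable_markedIntegrand z hΦ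
  -- the `Φ`-part alone, as a function of (w, s, ω₁, s', ω₂)
  set B : ℂ × (ℝ × WienerPair) × (ℝ × WienerPair) → ℝ≥0∞ := fun r ↦
    Φ ((bridgeFun z r.1 r.2.1, r.2.1.1), (bridgeFun r.1 z r.2.2, r.2.2.1)) with hB
  have hBm : Measurable B := by
    refine hΦ.comp ?_
    refine (Measurable.prodMk ?_ (measurable_fst.comp (measurable_fst.comp measurable_snd))).prodMk
      (Measurable.prodMk ?_ (measurable_fst.comp (measurable_snd.comp measurable_snd)))
    · exact measurable_bridgeFun.comp (measurable_const.prodMk (measurable_fst.prodMk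
        (measurable_fst.comp measurable_snd)))
    · exact measurable_bridgeFun.comp (measurable_fst.prodMk (measurable_const.prodMk
        (measurable_snd.comp measurable_snd)))
  -- `IΦ (s, s', w) = ∫∫ Φ((bridge_s(z→w), s), (bridge_{s'}(w→z), s')) dℙ dℙ`
  set IΦ : (ℝ × ℝ) × ℂ → ℝ≥0∞ := fun r ↦
    ∫⁻ ω₁, ∫⁻ ω₂, B (r.2, (r.1.1, ω₁), (r.1.2, ω₂)) ∂P ∂P with hIΦ
  have hIΦm : Measurable IΦ := by
    have h1 : Measurable fun r : (((ℝ × ℝ) × ℂ) × WienerPair) × WienerPair ↦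
        B (r.1.1.2, (r.1.1.1.1, r.1.2), (r.1.1.1.2, r.2)) :=
      hBm.comp ((measurable_snd.comp (measurable_fst.comp measurable_fst)).prodMk
        ((((measurable_fst.comp (measurable_fst.comp (measurable_fst.comp measurable_fst))).prodMk
          (measurable_snd.comp measurable_fst))).prodMk
          ((measurable_snd.comp (measurable_fst.comp (measurable_fst.comp measurable_fst))).prodMk
            measurable_snd)))
    exact h1.lintegral_prod_right'.lintegral_prod_right'
  -- `g (s, s') = timeDensity (s+s') ∫ p_{ss'/(s+s')}(w − z) IΦ(s, s', w) dA(w)`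
  set g : ℝ × ℝ → ℝ≥0∞ := fun p ↦ timeDensity (p.1 + p.2) *
    ∫⁻ w, heat (p.1 * p.2 / (p.1 + p.2)) (w - z) * IΦ (p, w) with hg
  have hgm : Measurable g := by
    refine (measurable_timeDensity.comp (measurable_fst.add measurable_snd)).mul ?_
    have h0 : Measurable fun r : (ℝ × ℝ) × ℂ ↦ heat (r.1.1 * r.1.2 / (r.1.1 + r.1.2)) (r.2 - z) :=
      (((measurable_fst.comp measurable_fst).mul (measurable_snd.comp measurable_fst)).div
        ((measurable_fst.comp measurable_fst).add (measurable_snd.comp measurable_fst))).heat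
        (measurable_snd.sub measurable_const)
    have h1 : Measurable fun r : (ℝ × ℝ) × ℂ ↦
        heat (r.1.1 * r.1.2 / (r.1.1 + r.1.2)) (r.2 - z) * IΦ r := h0.mul hIΦm
    exact h1.lintegral_prod_right'
  ---------------------------------------------------------------- Step A: disintegrate `time ⊗ ℙ`
  have hF : Measurable fun r : (ℝ × WienerPair) × I ↦ Φ (pieces z r.1 r.2) :=
    hΦ.comp (measurable_pieces z)
  have hF1 : Measurable fun q : ℝ × WienerPair ↦ (∫⁻ u : I, Φ (pieces z q u)) * ENNReal.ofReal q.1 :=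
    hF.lintegral_prod_right'.mul (ENNReal.measurable_ofReal.comp measurable_fst)
  rw [lintegral_prod _ hF1.aemeasurable]
  rw [show timeMeasure = (volume.restrict (Ioi 0)).withDensity timeDensity from rfl,
    lintegral_withDensity_eq_lintegral_mul _ measurable_timeDensity hF1.lintegral_prod_right']
  ---------------------------------------------------------------- Step B: for `t > 0`, the `u`-integral
  have stepB : ∀ t : ℝ, 0 < t →
      timeDensity t * ∫⁻ ω, (∫⁻ u : I, Φ (pieces z (t, ω) u)) * ENNReal.ofReal t ∂P =
        ∫⁻ u : I, ENNReal.ofReal t * g (t * u, t * (1 - u)) := by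
    intro t ht
    have hFt : Measurable fun r : WienerPair × I ↦ Φ (pieces z (t, r.1) r.2) :=
      hF.comp ((measurable_const.prodMk measurable_fst).prodMk measurable_snd)
    -- swap `ω` and `u`
    have hsw : ∫⁻ ω, ∫⁻ u : I, Φ (pieces z (t, ω) u) ∂volume ∂P =
        ∫⁻ u : I, ∫⁻ ω, Φ (pieces z (t, ω) u) ∂P ∂volume :=
      lintegral_lintegral_swap hFt.aemeasurable
    have hTu : Measurable fun u : I ↦ ((t * u, t * (1 - u)) : ℝ × ℝ) :=
      (measurable_const.mul measurable_subtype_coe).prodMk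
        (measurable_const.mul (measurable_const.sub measurable_subtype_coe))
    have hgu : Measurable fun u : I ↦ g (t * u, t * (1 - u)) := hgm.comp hTu
    rw [lintegral_mul_const _ hFt.lintegral_prod_right', hsw, lintegral_const_mul _ hgu]
    rw [show timeDensity t * ((∫⁻ u : I, ∫⁻ ω, Φ (pieces z (t, ω) u) ∂P) * ENNReal.ofReal t) =
      ENNReal.ofReal t * (timeDensity t * ∫⁻ u : I, ∫⁻ ω, Φ (pieces z (t, ω) u) ∂P) by ring]
    congr 1
    have hne : timeDensity t ≠ ∞ := ENNReal.ofReal_ne_top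
    rw [← lintegral_const_mul' _ _ hne]
    refine lintegral_congr_ae (ae_unitInterval_pos_lt_one.mono fun u hu ↦ ?_)
    show timeDensity t * ∫⁻ ω, Φ (pieces z (t, ω) u) ∂P = g (t * u, t * (1 - u))
    have hpc := lintegral_pieces_eq z ht hu.1 hu.2 hΦ
    rw [show ∫⁻ ω, Φ (pieces z (t, ω) u) ∂P = _ from hpc]
    have e1 : t * u + t * (1 - u) = t := by ring
    have e2 : t * u * (t * (1 - u)) / t = t * ((u : ℝ) - (u : ℝ) ^ 2) := by
      field_simp
    simp only [hg, hIΦ, hB, e1, e2]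
    rfl
  have hA2 : ∫⁻ t in Ioi 0, (timeDensity * fun t ↦
      ∫⁻ ω, (∫⁻ u : I, Φ (pieces z (t, ω) u)) * ENNReal.ofReal t ∂P) t =
      ∫⁻ t in Ioi 0, ∫⁻ u : I, ENNReal.ofReal t * g (t * u, t * (1 - u)) :=
    setLIntegral_congr_fun measurableSet_Ioi fun t ht ↦ stepB t ht
  rw [hA2, lintegral_Ioi_unitInterval_split hgm]
  ---------------------------------------------------------------- Step C: `g (s, s')` for `s, s' > 0`
  have stepC : ∀ s s' : ℝ, 0 < s → 0 < s' →
      g (s, s') = ∫⁻ w, ∫⁻ ω₁, ∫⁻ ω₂, Q (w, (s, ω₁), (s', ω₂)) ∂P ∂P := by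
    intro s s' hs hs'
    have hne : timeDensity (s + s') ≠ ∞ := ENNReal.ofReal_ne_top
    have hK : ∀ w, timeDensity (s + s') * heat (s * s' / (s + s')) (w - z) =
        heat s (w - z) * heat s' (z - w) / ENNReal.ofReal (s + s') := fun w ↦ by
      rw [timeDensity_mul_heat hs hs', ← heat_neg s' (w - z), neg_sub]
    have hKne : ∀ w, heat s (w - z) * heat s' (z - w) / ENNReal.ofReal (s + s') ≠ ∞ := fun w ↦
      ENNReal.div_ne_top (ENNReal.mul_ne_top
        (ENNReal.mul_ne_top ENNReal.ofReal_ne_top ENNReal.ofReal_ne_top)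
        (ENNReal.mul_ne_top ENNReal.ofReal_ne_top ENNReal.ofReal_ne_top))
        ((ENNReal.ofReal_pos.2 (add_pos hs hs')).ne')
    simp only [hg]
    rw [← lintegral_const_mul' _ _ hne]
    refine lintegral_congr fun w ↦ ?_
    rw [← mul_assoc, hK w, mul_comm, hIΦ]
    simp only
    rw [← lintegral_mul_const' _ _ (hKne w)]
    refine lintegral_congr fun ω₁ ↦ ?_
    rw [← lintegral_mul_const' _ _ (hKne w)]
  have stepC' : ∫⁻ s in Ioi 0, ∫⁻ s' in Ioi 0, g (s, s') =
      ∫⁻ s in Ioi 0, ∫⁻ s' in Ioi 0, ∫⁻ w, ∫⁻ ω₁, ∫⁻ ω₂, Q (w, (s, ω₁), (s', ω₂)) ∂P ∂P := by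
    refine setLIntegral_congr_fun measurableSet_Ioi fun s hs ↦ ?_
    exact setLIntegral_congr_fun measurableSet_Ioi fun s' hs' ↦ stepC s s' hs hs'
  rw [stepC']
  ---------------------------------------------------------------- Step D: reorder the integrals
  -- measurability of the partial integrals of `Q`
  have hQ5 : Measurable fun r : (ℝ × ℝ × ℂ × WienerPair) × WienerPair ↦
      Q (r.1.2.2.1, (r.1.1, r.1.2.2.2), (r.1.2.1, r.2)) :=
    hQm.comp ((measurable_fst.comp (measurable_snd.comp (measurable_snd.comp measurable_fst))).prodMk
      (((measurable_fst.comp measurable_fst).prodMk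
        (measurable_snd.comp (measurable_snd.comp (measurable_snd.comp measurable_fst)))).prodMk
        ((measurable_fst.comp (measurable_snd.comp measurable_fst)).prodMk measurable_snd)))
  -- `H4 (s, s', w, ω₁) = ∫ Q dω₂`
  have hH4 : Measurable fun r : ℝ × ℝ × ℂ × WienerPair ↦
      ∫⁻ ω₂, Q (r.2.2.1, (r.1, r.2.2.2), (r.2.1, ω₂)) ∂P := hQ5.lintegral_prod_right'
  -- `H3 (s, s', w) = ∫∫ Q dω₂ dω₁`
  have hH3 : Measurable fun r : ℝ × ℝ × ℂ ↦
      ∫⁻ ω₁, ∫⁻ ω₂, Q (r.2.2, (r.1, ω₁), (r.2.1, ω₂)) ∂P ∂P := by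
    have h := hH4.comp (f := fun r : (ℝ × ℝ × ℂ) × WienerPair ↦ (r.1.1, r.1.2.1, r.1.2.2, r.2))
      (((measurable_fst.comp measurable_fst).prodMk
        (((measurable_fst.comp (measurable_snd.comp measurable_fst))).prodMk
          (((measurable_snd.comp (measurable_snd.comp measurable_fst))).prodMk measurable_snd))))
    exact h.lintegral_prod_right'
  -- swap `s'` and `w`, then `s` and `w`
  have sw1 : ∀ s, ∫⁻ s' in Ioi 0, ∫⁻ w, ∫⁻ ω₁, ∫⁻ ω₂, Q (w, (s, ω₁), (s', ω₂)) ∂P ∂P =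
      ∫⁻ w, ∫⁻ s' in Ioi 0, ∫⁻ ω₁, ∫⁻ ω₂, Q (w, (s, ω₁), (s', ω₂)) ∂P ∂P := fun s ↦
    lintegral_lintegral_swap ((hH3.comp (measurable_const.prodMk measurable_id)).aemeasurable)
  simp_rw [sw1]
  have hH2 : Measurable fun r : ℝ × ℂ ↦
      ∫⁻ s' in Ioi 0, ∫⁻ ω₁, ∫⁻ ω₂, Q (r.2, (r.1, ω₁), (s', ω₂)) ∂P ∂P := by
    have h := hH3.comp (f := fun r : (ℝ × ℂ) × ℝ ↦ (r.1.1, r.2, r.1.2))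
      ((measurable_fst.comp measurable_fst).prodMk (measurable_snd.prodMk
        (measurable_snd.comp measurable_fst)))
    exact h.lintegral_prod_right' (ν := volume.restrict (Ioi 0))
  rw [show (∫⁻ s in Ioi 0, ∫⁻ w, ∫⁻ s' in Ioi 0, ∫⁻ ω₁, ∫⁻ ω₂, Q (w, (s, ω₁), (s', ω₂)) ∂P ∂P) =
      ∫⁻ w, ∫⁻ s in Ioi 0, ∫⁻ s' in Ioi 0, ∫⁻ ω₁, ∫⁻ ω₂, Q (w, (s, ω₁), (s', ω₂)) ∂P ∂P from
    lintegral_lintegral_swap hH2.aemeasurable]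
  refine lintegral_congr fun w ↦ ?_
  -- inner: swap `s'` and `ω₁`, then fold the two product integrals
  have hH4w : ∀ s, Measurable fun r : ℝ × WienerPair ↦
      ∫⁻ ω₂, Q (w, (s, r.2), (r.1, ω₂)) ∂P := fun s ↦ by
    have h := hH4.comp (f := fun r : ℝ × WienerPair ↦ (s, r.1, w, r.2))
      (measurable_const.prodMk (measurable_fst.prodMk (measurable_const.prodMk measurable_snd)))
    exact h
  have sw3 : ∀ s, ∫⁻ s' in Ioi 0, ∫⁻ ω₁, ∫⁻ ω₂, Q (w, (s, ω₁), (s', ω₂)) ∂P ∂P =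
      ∫⁻ ω₁, ∫⁻ s' in Ioi 0, ∫⁻ ω₂, Q (w, (s, ω₁), (s', ω₂)) ∂P ∂volume ∂P := fun s ↦
    lintegral_lintegral_swap ((hH4w s).aemeasurable)
  simp_rw [sw3]
  have hQw : ∀ s ω₁, Measurable fun q₂ : ℝ × WienerPair ↦ Q (w, (s, ω₁), q₂) := fun s ω₁ ↦ by
    have h := hQm.comp (f := fun q₂ : ℝ × WienerPair ↦ (w, (s, ω₁), q₂))
      (measurable_const.prodMk (measurable_const.prodMk measurable_id))
    exact h
  have fold2 : ∀ s ω₁, ∫⁻ s' in Ioi 0, ∫⁻ ω₂, Q (w, (s, ω₁), (s', ω₂)) ∂P ∂volume =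
      ∫⁻ q₂, Q (w, (s, ω₁), q₂) ∂((volume.restrict (Ioi 0)).prod P) := fun s ω₁ ↦
    (lintegral_prod (fun q₂ : ℝ × WienerPair ↦ Q (w, (s, ω₁), q₂)) (hQw s ω₁).aemeasurable).symm
  simp_rw [fold2]
  have hq1 : Measurable fun q₁ : ℝ × WienerPair ↦
      ∫⁻ q₂, Q (w, q₁, q₂) ∂((volume.restrict (Ioi 0)).prod P) := by
    have h := hQm.comp (f := fun r : (ℝ × WienerPair) × (ℝ × WienerPair) ↦ (w, r.1, r.2))
      (measurable_const.prodMk (measurable_fst.prodMk measurable_snd))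
    exact h.lintegral_prod_right'
  exact (lintegral_prod (fun q₁ : ℝ × WienerPair ↦
    ∫⁻ q₂, Q (w, q₁, q₂) ∂((volume.restrict (Ioi 0)).prod P)) hq1.aemeasurable).symm

end BrownianLoop

end Literature.Probability.RandomPlanarGeometry

end

/-!
# The marked decomposition of the rooted Brownian loop, on path space `C([0,1], ℂ)`

`BrownianLoopMarkedDecomposition.lintegral_marked_split` (Lawler, *Conformally Invariant Processes
in the Plane* (2005), §5.2: the rooted loop measure with a uniform mark is
`∫ dA(w) ∫∫ (s+s')⁻¹ [μ(z, w; s) ⊕ μ(w, z; s')]`) is stated for functionals of the two pieces as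
elements of the product space `[0,1] → ℂ`. Functionals built from the loop structure (the
unbased loop of the concatenation, images under maps continuous on a domain, running integrals)
live on the path space `C([0,1], ℂ)`; this file transfers the identity there:

* `measurableSpace_eq_comap_coeFn₂` — the Borel σ-algebra of
  `(C([0,1],ℂ) × ℝ) × (C([0,1],ℂ) × ℝ)` is the pull-back of the product σ-algebra of
  `(([0,1] → ℂ) × ℝ)²` under the coercion (Billingsley's Example 1.3, product form), whence
  `measure_eq_of_map_coeFn₂_eq`: two measures on it with the same push-forward agree;
* `piecesCM` — the pieces as continuous paths (the bridges `bridgeFunCM` are in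
  `BrownianSegmentLaw`);
* `lintegral_marked_split_path` — **the marked decomposition for every measurable `Φ ≥ 0` on
  `(C([0,1],ℂ) × ℝ)²`**.

## References

* G. F. Lawler, *Conformally Invariant Processes in the Plane*, AMS (2005), §5.2.
* P. Billingsley, *Convergence of Probability Measures* (2nd ed., 1999), Example 1.3.
-/

noncomputable section

open Set MeasureTheory ProbabilityTheory unitInterval
open scoped unitInterval NNReal ENNReal

namespace Literature.Probability.RandomPlanarGeometry

open Literature.Probability.Process (WienerPair wienerPair)

namespace BrownianLoop

variable [MeasurableSpace C(I, ℂ)] [BorelSpace C(I, ℂ)]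

/-! ### The σ-algebra of `(C([0,1],ℂ) × ℝ)²` is pulled back from `(([0,1] → ℂ) × ℝ)²` -/

/-- The coercion `(C([0,1],ℂ) × ℝ)² → (([0,1] → ℂ) × ℝ)²`. [folklore] -/
def coeFn₂ (x : (C(I, ℂ) × ℝ) × (C(I, ℂ) × ℝ)) : ((I → ℂ) × ℝ) × ((I → ℂ) × ℝ) :=
  ((⇑x.1.1, x.1.2), (⇑x.2.1, x.2.2))

/-- `coeFn₂` is measurable. [folklore] -/
theorem measurable_coeFn₂ : Measurable (coeFn₂ : (C(I, ℂ) × ℝ) × (C(I, ℂ) × ℝ) → _) := by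
  have hc : Measurable fun x : C(I, ℂ) ↦ (⇑x : I → ℂ) :=
    measurable_pi_lambda _ fun u ↦ measurable_eval_continuousMap u
  exact ((hc.comp (measurable_fst.comp measurable_fst)).prodMk (measurable_snd.comp measurable_fst)).prodMk
    ((hc.comp (measurable_fst.comp measurable_snd)).prodMk (measurable_snd.comp measurable_snd))

omit [MeasurableSpace C(I, ℂ)] [BorelSpace C(I, ℂ)] in
/-- `coeFn₂` is injective. [folklore] -/
theorem injective_coeFn₂ : Function.Injective (coeFn₂ : (C(I, ℂ) × ℝ) × (C(I, ℂ) × ℝ) → _) := by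
  rintro ⟨⟨a, s⟩, ⟨b, t⟩⟩ ⟨⟨a', s'⟩, ⟨b', t'⟩⟩ h
  simp only [coeFn₂, Prod.mk.injEq, DFunLike.coe_fn_eq] at h
  obtain ⟨⟨rfl, rfl⟩, ⟨rfl, rfl⟩⟩ := h
  rfl

/-- **The σ-algebra of `(C([0,1],ℂ) × ℝ)²` is the pull-back of the product σ-algebra of
`(([0,1] → ℂ) × ℝ)²` under the coercion.** [cite: Billingsley1999, Example 1.3] -/
theorem measurableSpace_eq_comap_coeFn₂ :
    (Prod.instMeasurableSpace : MeasurableSpace ((C(I, ℂ) × ℝ) × (C(I, ℂ) × ℝ))) =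
      MeasurableSpace.comap coeFn₂ Prod.instMeasurableSpace := by
  have h1 : (Prod.instMeasurableSpace : MeasurableSpace (C(I, ℂ) × ℝ)) =
      MeasurableSpace.comap (fun x : C(I, ℂ) × ℝ ↦ ((⇑x.1 : I → ℂ), x.2))
        (Prod.instMeasurableSpace : MeasurableSpace ((I → ℂ) × ℝ)) := by
    change MeasurableSpace.comap Prod.fst _ ⊔ MeasurableSpace.comap Prod.snd _ =
      MeasurableSpace.comap _ (MeasurableSpace.comap Prod.fst _ ⊔ MeasurableSpace.comap Prod.snd _)
    rw [MeasurableSpace.comap_sup, MeasurableSpace.comap_comp, MeasurableSpace.comap_comp,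
      measurableSpace_continuousMap_eq_comap, MeasurableSpace.comap_comp]
    rfl
  change MeasurableSpace.comap Prod.fst (Prod.instMeasurableSpace : MeasurableSpace (C(I, ℂ) × ℝ)) ⊔
      MeasurableSpace.comap Prod.snd (Prod.instMeasurableSpace : MeasurableSpace (C(I, ℂ) × ℝ)) =
    MeasurableSpace.comap _ (MeasurableSpace.comap Prod.fst _ ⊔ MeasurableSpace.comap Prod.snd _)
  rw [MeasurableSpace.comap_sup, MeasurableSpace.comap_comp, MeasurableSpace.comap_comp, h1,
    MeasurableSpace.comap_comp, MeasurableSpace.comap_comp]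
  rfl

/-- **Two measures on `(C([0,1],ℂ) × ℝ)²` with the same push-forward to `(([0,1] → ℂ) × ℝ)²`
are equal.** [folklore] -/
theorem measure_eq_of_map_coeFn₂_eq {μ ν : Measure ((C(I, ℂ) × ℝ) × (C(I, ℂ) × ℝ))}
    (h : μ.map coeFn₂ = ν.map coeFn₂) : μ = ν := by
  ext A hA
  have hA' : MeasurableSet[MeasurableSpace.comap coeFn₂ Prod.instMeasurableSpace] A := by
    rw [← measurableSpace_eq_comap_coeFn₂]; exact hA
  obtain ⟨B, hB, rfl⟩ := MeasurableSpace.measurableSet_comap.1 hA'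
  rw [← Measure.map_apply measurable_coeFn₂ hB, ← Measure.map_apply measurable_coeFn₂ hB, h]

/-! ### The pieces and the bridges as continuous paths -/

variable (z : ℂ)

/-- The two pieces of the rooted loop as continuous paths, with their durations. [folklore] -/
def piecesCM (q : ℝ × WienerPair) (u : I) : (C(I, ℂ) × ℝ) × (C(I, ℂ) × ℝ) :=
  ((⟨fun v ↦ rootedFun (z, q) (fstTime u v), (continuous_rootedFun _).comp
      ((continuous_const.mul continuous_induced_dom).subtype_mk _)⟩, q.1 * u),
    (⟨fun v ↦ rootedFun (z, q) (sndTime u v), (continuous_rootedFun _).comp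
      (unitInterval.continuous_symm.comp (((continuous_const.mul
        (continuous_induced_dom.comp unitInterval.continuous_symm))).subtype_mk _))⟩,
      q.1 * (1 - u)))

omit [MeasurableSpace C(I, ℂ)] [BorelSpace C(I, ℂ)] in
/-- `coeFn₂ ∘ piecesCM = pieces`. [folklore] -/
@[simp] theorem coeFn₂_piecesCM (q : ℝ × WienerPair) (u : I) :
    coeFn₂ (piecesCM z q u) = pieces z q u := rfl

/-- Measurability of `piecesCM` in (duration, sample, fraction). [folklore] -/
theorem measurable_piecesCM : Measurable fun r : (ℝ × WienerPair) × I ↦ piecesCM z r.1 r.2 := by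
  have h := measurable_pieces z
  have h11 : Measurable fun r : (ℝ × WienerPair) × I ↦ (piecesCM z r.1 r.2).1.1 :=
    measurable_of_eval fun v ↦ by
      have := (measurable_pi_apply v).comp (measurable_fst.comp (measurable_fst.comp h))
      exact this
  have h21 : Measurable fun r : (ℝ × WienerPair) × I ↦ (piecesCM z r.1 r.2).2.1 :=
    measurable_of_eval fun v ↦ by
      have := (measurable_pi_apply v).comp (measurable_fst.comp (measurable_snd.comp h))
      exact this
  have h12 : Measurable fun r : (ℝ × WienerPair) × I ↦ (piecesCM z r.1 r.2).1.2 := by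
    have := measurable_snd.comp (measurable_fst.comp h)
    exact this
  have h22 : Measurable fun r : (ℝ × WienerPair) × I ↦ (piecesCM z r.1 r.2).2.2 := by
    have := measurable_snd.comp (measurable_snd.comp h)
    exact this
  exact (h11.prodMk h12).prodMk (h21.prodMk h22)

/-! ### The marked decomposition on path space -/

/-- **The marked decomposition of the rooted Brownian loop measure, for functionals on path
space**: `lintegral_marked_split` for every measurable `Φ ≥ 0` on `(C([0,1],ℂ) × ℝ)²`
([Lawler] §5.2, Chapman–Kolmogorov; transferred along `measure_eq_of_map_coeFn₂_eq`).
[cite: Lawler2005ConformallyInvariant, §5.2] -/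
theorem lintegral_marked_split_path {Φ : (C(I, ℂ) × ℝ) × (C(I, ℂ) × ℝ) → ℝ≥0∞}
    (hΦ : Measurable Φ) :
    ∫⁻ q, (∫⁻ u : I, Φ (piecesCM z q u)) * ENNReal.ofReal q.1 ∂(timeMeasure.prod wienerPair) =
      ∫⁻ w, ∫⁻ q₁, ∫⁻ q₂, Φ ((bridgeFunCM z w q₁, q₁.1), (bridgeFunCM w z q₂, q₂.1)) *
          (heat q₁.1 (w - z) * heat q₂.1 (z - w) / ENNReal.ofReal (q₁.1 + q₂.1))
        ∂((volume.restrict (Ioi 0)).prod wienerPair)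
        ∂((volume.restrict (Ioi 0)).prod wienerPair) := by
  -- the two sides as integrals of `Φ` against two measures on path space
  set P : Measure WienerPair := wienerPair with hP
  set ν : Measure (ℝ × WienerPair) := (volume.restrict (Ioi 0)).prod P with hν
  set μ₁ : Measure ((C(I, ℂ) × ℝ) × (C(I, ℂ) × ℝ)) :=
    (((timeMeasure.prod P).prod (volume : Measure I)).withDensity
      (fun r ↦ ENNReal.ofReal r.1.1)).map (fun r ↦ piecesCM z r.1 r.2) with hμ₁
  set K : ℂ × (ℝ × WienerPair) × (ℝ × WienerPair) → ℝ≥0∞ := fun r ↦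
    heat r.2.1.1 (r.1 - z) * heat r.2.2.1 (z - r.1) / ENNReal.ofReal (r.2.1.1 + r.2.2.1) with hK
  set BC : ℂ × (ℝ × WienerPair) × (ℝ × WienerPair) → (C(I, ℂ) × ℝ) × (C(I, ℂ) × ℝ) := fun r ↦
    ((bridgeFunCM z r.1 r.2.1, r.2.1.1), (bridgeFunCM r.1 z r.2.2, r.2.2.1)) with hBC
  set μ₂ : Measure ((C(I, ℂ) × ℝ) × (C(I, ℂ) × ℝ)) :=
    (((volume : Measure ℂ).prod (ν.prod ν)).withDensity K).map BC with hμ₂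
  have hKm : Measurable K := by
    have h1 : Measurable fun r : ℂ × (ℝ × WienerPair) × (ℝ × WienerPair) ↦ heat r.2.1.1 (r.1 - z) :=
      (measurable_fst.comp (measurable_fst.comp measurable_snd)).heat
        (measurable_fst.sub measurable_const)
    have h2 : Measurable fun r : ℂ × (ℝ × WienerPair) × (ℝ × WienerPair) ↦ heat r.2.2.1 (z - r.1) :=
      (measurable_fst.comp (measurable_snd.comp measurable_snd)).heat
        (measurable_const.sub measurable_fst)
    exact (h1.mul h2).div (ENNReal.measurable_ofReal.comp
      ((measurable_fst.comp (measurable_fst.comp measurable_snd)).add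
        (measurable_fst.comp (measurable_snd.comp measurable_snd))))
  have hBCm : Measurable BC := by
    have hb1' : Measurable fun r : ℂ × (ℝ × WienerPair) × (ℝ × WienerPair) ↦ bridgeFun z r.1 r.2.1 :=
      measurable_bridgeFun.comp (measurable_const.prodMk (measurable_fst.prodMk
        (measurable_fst.comp measurable_snd)))
    have hb2' : Measurable fun r : ℂ × (ℝ × WienerPair) × (ℝ × WienerPair) ↦ bridgeFun r.1 z r.2.2 :=
      measurable_bridgeFun.comp (measurable_fst.prodMk (measurable_const.prodMk
        (measurable_snd.comp measurable_snd)))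
    have hb1 : Measurable fun r : ℂ × (ℝ × WienerPair) × (ℝ × WienerPair) ↦ bridgeFunCM z r.1 r.2.1 :=
      measurable_of_eval fun v ↦ by
        have := (measurable_pi_apply v).comp hb1'
        exact this
    have hb2 : Measurable fun r : ℂ × (ℝ × WienerPair) × (ℝ × WienerPair) ↦ bridgeFunCM r.1 z r.2.2 :=
      measurable_of_eval fun v ↦ by
        have := (measurable_pi_apply v).comp hb2'
        exact this
    exact (hb1.prodMk (measurable_fst.comp (measurable_fst.comp measurable_snd))).prodMk
      (hb2.prodMk (measurable_fst.comp (measurable_snd.comp measurable_snd)))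
  have hpm : Measurable fun r : (ℝ × WienerPair) × I ↦ piecesCM z r.1 r.2 := measurable_piecesCM z
  -- integrals against `μ₁`, `μ₂`
  have hI1 : ∀ {F : (C(I, ℂ) × ℝ) × (C(I, ℂ) × ℝ) → ℝ≥0∞}, Measurable F →
      ∫⁻ x, F x ∂μ₁ = ∫⁻ q, (∫⁻ u : I, F (piecesCM z q u)) * ENNReal.ofReal q.1
        ∂(timeMeasure.prod P) := by
    intro F hF
    have hFp : Measurable fun r : (ℝ × WienerPair) × I ↦ F (piecesCM z r.1 r.2) := hF.comp hpm
    have hd : Measurable fun r : (ℝ × WienerPair) × I ↦ ENNReal.ofReal r.1.1 :=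
      ENNReal.measurable_ofReal.comp (measurable_fst.comp measurable_fst)
    have hprod : Measurable fun r : (ℝ × WienerPair) × I ↦ ENNReal.ofReal r.1.1 * F (piecesCM z r.1 r.2) :=
      hd.mul hFp
    rw [hμ₁, lintegral_map hF hpm, lintegral_withDensity_eq_lintegral_mul _ hd hFp]
    simp only [Pi.mul_apply]
    rw [lintegral_prod _ hprod.aemeasurable]
    refine lintegral_congr fun q ↦ ?_
    have hFq : Measurable fun u : I ↦ F (piecesCM z q u) :=
      hFp.comp (measurable_const.prodMk measurable_id)
    rw [← lintegral_mul_const _ hFq]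
    exact lintegral_congr fun u ↦ mul_comm _ _
  have hI2 : ∀ {F : (C(I, ℂ) × ℝ) × (C(I, ℂ) × ℝ) → ℝ≥0∞}, Measurable F →
      ∫⁻ x, F x ∂μ₂ = ∫⁻ w, ∫⁻ q₁, ∫⁻ q₂, F (BC (w, q₁, q₂)) * K (w, q₁, q₂) ∂ν ∂ν := by
    intro F hF
    haveI : SFinite ν := by rw [hν]; infer_instance
    have hFB : Measurable fun r ↦ F (BC r) := hF.comp hBCm
    have hprod : Measurable fun r ↦ K r * F (BC r) := hKm.mul hFB
    rw [hμ₂, lintegral_map hF hBCm, lintegral_withDensity_eq_lintegral_mul _ hKm hFB,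
      show (fun a ↦ (K * fun r ↦ F (BC r)) a) = fun r ↦ K r * F (BC r) from rfl,
      lintegral_prod _ hprod.aemeasurable]
    refine lintegral_congr fun w ↦ ?_
    have hw : Measurable fun r : (ℝ × WienerPair) × (ℝ × WienerPair) ↦ K (w, r) * F (BC (w, r)) :=
      hprod.comp (measurable_const.prodMk measurable_id)
    rw [lintegral_prod _ hw.aemeasurable]
    exact lintegral_congr fun q₁ ↦ lintegral_congr fun q₂ ↦ mul_comm _ _
  -- the two push-forwards agree, by the `[0,1] → ℂ` statement
  have hmaps : μ₁.map coeFn₂ = μ₂.map coeFn₂ := by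
    ext A hA
    have hind : Measurable ((coeFn₂ ⁻¹' A).indicator (1 : (C(I, ℂ) × ℝ) × (C(I, ℂ) × ℝ) → ℝ≥0∞)) :=
      measurable_one.indicator (measurable_coeFn₂ hA)
    rw [Measure.map_apply measurable_coeFn₂ hA, Measure.map_apply measurable_coeFn₂ hA,
      ← lintegral_indicator_one (measurable_coeFn₂ hA),
      ← lintegral_indicator_one (measurable_coeFn₂ hA), hI1 hind, hI2 hind]
    have key := lintegral_marked_split z (measurable_one.indicator hA :
      Measurable (A.indicator (1 : ((I → ℂ) × ℝ) × ((I → ℂ) × ℝ) → ℝ≥0∞)))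
    have e1 : ∀ q u, (coeFn₂ ⁻¹' A).indicator (1 : (C(I, ℂ) × ℝ) × (C(I, ℂ) × ℝ) → ℝ≥0∞)
        (piecesCM z q u) = A.indicator 1 (pieces z q u) := fun q u ↦ rfl
    have e2 : ∀ w q₁ q₂, (coeFn₂ ⁻¹' A).indicator (1 : (C(I, ℂ) × ℝ) × (C(I, ℂ) × ℝ) → ℝ≥0∞)
        (BC (w, q₁, q₂)) =
        A.indicator 1 ((bridgeFun z w q₁, q₁.1), (bridgeFun w z q₂, q₂.1)) := fun w q₁ q₂ ↦ rfl
    simp_rw [e1, e2]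
    exact key
  have hμ : μ₁ = μ₂ := measure_eq_of_map_coeFn₂_eq hmaps
  rw [← hI1 hΦ, hμ, hI2 hΦ]

end BrownianLoop

end Literature.Probability.RandomPlanarGeometry

end

/-!
# Concatenating the two pieces of a Brownian loop: the unbased loop and the conformal clock

Lawler, *Conformally Invariant Processes in the Plane* (2005), §5.1–§5.2: the concatenation
`γ ⊕ γ'` of paths (`t_{γ⊕γ'} = t_γ + t_{γ'}`), used in the Chapman–Kolmogorov relation
`μ(z, z; s + s') = ∫ [μ(z, w; s) ⊕ μ(w, z; s')] dA(w)`, and the time change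
`t_{f∘γ} = ∫₀^{t_γ} |f'(γ(r))|² dr` (§5.1), which is additive under concatenation. On the tree's
carrier `UnbasedLoop ℂ` (closed curves modulo reparametrisation) the unbased loop of a
concatenation does not depend on the fraction of time allotted to each piece, so we concatenate
at the fraction `1/2`:

* `concatCM a b` — the concatenation of two continuous paths on `[0,1]` (second piece translated
  to start where the first ends, so that the operation is defined and measurable on all of
  `C([0,1],ℂ)²`; it is the plain concatenation when `a 1 = b 0`); `range_concatCM`,
  `measurable_concatCM`;
* `unrootCM_concatCM_piecesCM` — **re-assembling the two pieces of the rooted Brownian loop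
  gives back its unbased loop** (a monotone reparametrisation, `reparamDist_eq_zero_of_monotone'`);
  `range_rooted_eq_union` — its trace is the union of the traces of the pieces;
* `clock_pieces` — **additivity of the conformal clock**:
  `t·∫₀¹|f'(γ)|² = (tu)·∫₀¹|f'(piece₁)|² + (t(1−u))·∫₀¹|f'(piece₂)|²`;
* `lintegral_markWeight` — `∫₀¹ |f'(γ(u))|² du / ∫₀¹|f'(γ)|² = 1` (the density inserting a mark
  distributed proportionally to the clock).

## References

* G. F. Lawler, *Conformally Invariant Processes in the Plane*, AMS (2005), §5.1, §5.2.
-/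

noncomputable section

open Set MeasureTheory unitInterval
open scoped unitInterval NNReal ENNReal

namespace Literature.Probability.RandomPlanarGeometry

open Literature.Probability.Process (WienerPair wienerPair)

namespace BrownianLoop

/-! ### Concatenation at the fraction `1/2` -/

/-- `r ↦ 2r`, clamped to `[0,1]`. [folklore] -/
def dbl₁ (r : I) : I := projIcc 0 1 zero_le_one (2 * r)

/-- `r ↦ 2r − 1`, clamped to `[0,1]`. [folklore] -/
def dbl₂ (r : I) : I := projIcc 0 1 zero_le_one (2 * r - 1)

/-- `dbl₁` is continuous. [folklore] -/
@[fun_prop] theorem continuous_dbl₁ : Continuous dbl₁ :=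
  continuous_projIcc.comp (continuous_const.mul continuous_induced_dom)

/-- `dbl₂` is continuous. [folklore] -/
@[fun_prop] theorem continuous_dbl₂ : Continuous dbl₂ :=
  continuous_projIcc.comp ((continuous_const.mul continuous_induced_dom).sub continuous_const)

/-- Value of `dbl₁` on `[0, 1/2]`. [folklore] -/
theorem coe_dbl₁ {r : I} (hr : (r : ℝ) ≤ 1 / 2) : (dbl₁ r : ℝ) = 2 * r := by
  rw [dbl₁, projIcc_of_mem _ ⟨by linarith [r.2.1], by linarith⟩]

/-- Value of `dbl₂` on `[1/2, 1]`. [folklore] -/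
theorem coe_dbl₂ {r : I} (hr : 1 / 2 ≤ (r : ℝ)) : (dbl₂ r : ℝ) = 2 * r - 1 := by
  rw [dbl₂, projIcc_of_mem _ ⟨by linarith, by linarith [r.2.2]⟩]

/-- **Concatenation of two continuous paths on `[0,1]` at the fraction `1/2`**, the second piece
translated to start at the end of the first (a no-op when `a 1 = b 0`) ([Lawler] §5.1, `γ ⊕ γ'`,
in unit-time parametrisation). [cite: Lawler2005ConformallyInvariant, §5.1] -/
def concatCM (a b : C(I, ℂ)) : C(I, ℂ) where
  toFun r := if (r : ℝ) ≤ 1 / 2 then a (dbl₁ r) else b (dbl₂ r) + (a 1 - b 0)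
  continuous_toFun := by
    refine Continuous.if_le (by fun_prop) (by fun_prop) continuous_induced_dom continuous_const ?_
    intro r hr
    have h1 : dbl₁ r = 1 := Subtype.ext (by rw [coe_dbl₁ hr.le, hr]; norm_num)
    have h2 : dbl₂ r = 0 := Subtype.ext (by rw [coe_dbl₂ hr.ge, hr]; norm_num)
    rw [h1, h2]
    ring

/-- Pointwise formula for `concatCM`. [folklore] -/
theorem concatCM_apply (a b : C(I, ℂ)) (r : I) :
    concatCM a b r = if (r : ℝ) ≤ 1 / 2 then a (dbl₁ r) else b (dbl₂ r) + (a 1 - b 0) := rfl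

/-- With matching endpoints the concatenation is the plain one. [folklore] -/
theorem concatCM_apply_of_eq {a b : C(I, ℂ)} (h : a 1 = b 0) (r : I) :
    concatCM a b r = if (r : ℝ) ≤ 1 / 2 then a (dbl₁ r) else b (dbl₂ r) := by
  rw [concatCM_apply, h, sub_self, add_zero]

/-- The concatenation starts where `a` starts. [folklore] -/
theorem concatCM_zero (a b : C(I, ℂ)) : concatCM a b 0 = a 0 := by
  rw [concatCM_apply, if_pos (by norm_num)]
  congr 1
  exact Subtype.ext (by rw [coe_dbl₁ (by norm_num)]; simp)

/-- With matching endpoints the concatenation ends where `b` ends. [folklore] -/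
theorem concatCM_one {a b : C(I, ℂ)} (h : a 1 = b 0) : concatCM a b 1 = b 1 := by
  rw [concatCM_apply_of_eq h, if_neg (by norm_num)]
  congr 1
  exact Subtype.ext (by rw [coe_dbl₂ (by norm_num)]; norm_num)

/-- **The trace of a concatenation is the union of the traces.** [folklore] -/
theorem range_concatCM {a b : C(I, ℂ)} (h : a 1 = b 0) :
    range (concatCM a b) = range a ∪ range b := by
  apply le_antisymm
  · rintro _ ⟨r, rfl⟩
    rw [concatCM_apply_of_eq h]
    split_ifs
    · exact Or.inl ⟨_, rfl⟩
    · exact Or.inr ⟨_, rfl⟩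
  · rintro x (⟨v, rfl⟩ | ⟨v, rfl⟩)
    · refine ⟨⟨(v : ℝ) / 2, by constructor <;> linarith [v.2.1, v.2.2]⟩, ?_⟩
      rw [concatCM_apply_of_eq h, if_pos (by simp only; linarith [v.2.2])]
      congr 1
      exact Subtype.ext (by rw [coe_dbl₁ (by simp only; linarith [v.2.2])]; simp only; ring)
    · rcases eq_or_lt_of_le v.2.1 with hv | hv
      · -- `b 0 = a 1` is attained at `r = 1/2`
        have hv0 : v = 0 := Subtype.ext hv.symm
        subst hv0
        refine ⟨⟨1 / 2, by norm_num, by norm_num⟩, ?_⟩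
        have hle : (((⟨1 / 2, by norm_num, by norm_num⟩ : I) : ℝ)) ≤ 1 / 2 := le_rfl
        rw [concatCM_apply_of_eq h, if_pos hle]
        have hd : dbl₁ ⟨1 / 2, by norm_num, by norm_num⟩ = 1 :=
          Subtype.ext (by rw [coe_dbl₁ hle]; norm_num)
        rw [hd, h]
      · refine ⟨⟨((v : ℝ) + 1) / 2, by constructor <;> linarith [v.2.2]⟩, ?_⟩
        have hv' : ¬ (((v : ℝ) + 1) / 2 ≤ 1 / 2) := by simp only [not_le]; linarith
        rw [concatCM_apply_of_eq h, if_neg hv']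
        congr 1
        exact Subtype.ext (by rw [coe_dbl₂ (by simp only; linarith)]; simp only; ring)

section Measurable

variable [MeasurableSpace C(I, ℂ)] [BorelSpace C(I, ℂ)]

/-- `concatCM` is measurable on `C([0,1],ℂ)²`. [folklore] -/
theorem measurable_concatCM : Measurable fun p : C(I, ℂ) × C(I, ℂ) ↦ concatCM p.1 p.2 := by
  refine measurable_of_eval fun r ↦ ?_
  simp only [concatCM_apply]
  by_cases hr : (r : ℝ) ≤ 1 / 2
  · simp only [if_pos hr]
    exact (measurable_eval_continuousMap _).comp measurable_fst
  · simp only [if_neg hr]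
    exact ((measurable_eval_continuousMap _).comp measurable_snd).add
      (((measurable_eval_continuousMap _).comp measurable_fst).sub
        ((measurable_eval_continuousMap _).comp measurable_snd))

end Measurable

/-! ### Re-assembling the pieces of the rooted loop -/

variable (z : ℂ) (q : ℝ × WienerPair) {u : I}

/-- The pieces meet: `piece₁(1) = γ(u) = piece₂(0)`. [folklore] -/
theorem piecesCM_junction (u : I) : (piecesCM z q u).1.1 1 = (piecesCM z q u).2.1 0 := by
  show rootedFun (z, q) (fstTime u 1) = rootedFun (z, q) (sndTime u 0)
  congr 1
  exact Subtype.ext (by simp)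

/-- `piece₁(1) = γ(u)`. [folklore] -/
theorem piecesCM_fst_one (u : I) : (piecesCM z q u).1.1 1 = rootedFun (z, q) u := by
  show rootedFun (z, q) (fstTime u 1) = rootedFun (z, q) u
  congr 1
  exact Subtype.ext (by simp)

/-- The rooted loop is closed. [folklore] -/
theorem rootedFun_zero_eq_one : rootedFun (z, q) 0 = rootedFun (z, q) 1 := by
  simp [rootedFun]

/-- The concatenation of the pieces is closed. [folklore] -/
theorem concatCM_piecesCM_closed (u : I) :
    concatCM (piecesCM z q u).1.1 (piecesCM z q u).2.1 0 =
      concatCM (piecesCM z q u).1.1 (piecesCM z q u).2.1 1 := by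
  rw [concatCM_zero, concatCM_one (piecesCM_junction z q u)]
  show rootedFun (z, q) (fstTime u 0) = rootedFun (z, q) (sndTime u 1)
  rw [show fstTime u 0 = 0 from Subtype.ext (by simp), show sndTime u 1 = 1 from
    Subtype.ext (by simp), rootedFun_zero_eq_one]

/-- The time change `h_u` taking the concatenation at fraction `1/2` to the original loop:
`r ↦ 2ur` on `[0, 1/2]`, `r ↦ u + (1−u)(2r−1)` on `[1/2, 1]`. [folklore] -/
def fracChange (u : I) (r : ℝ) : ℝ := if r ≤ 1 / 2 then (u : ℝ) * (2 * r) else u + (1 - u) * (2 * r - 1)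

/-- `fracChange u` is continuous. [folklore] -/
theorem continuous_fracChange (u : I) : Continuous (fracChange u) := by
  refine Continuous.if_le (by fun_prop) (by fun_prop) continuous_id continuous_const ?_
  intro r hr
  rw [hr]
  ring

/-- `fracChange u` is monotone. [folklore] -/
theorem monotone_fracChange (u : I) : Monotone (fracChange u) := by
  intro r s hrs
  simp only [fracChange]
  have hu0 := u.2.1
  have hu1 := u.2.2
  split_ifs with h1 h2 h2
  · nlinarith
  · nlinarith
  · exact absurd (hrs.trans h2) h1
  · nlinarith

/-- **Re-assembling the two pieces of the rooted Brownian loop gives back its unbased loop**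
(the concatenation at fraction `1/2` is a monotone reparametrisation of `γ_{z,q}`).
[cite: Lawler2005ConformallyInvariant, §5.1] -/
theorem unrootCM_concatCM_piecesCM (u : I) :
    unrootCM (concatCM (piecesCM z q u).1.1 (piecesCM z q u).2.1) = unrooted (z, q) := by
  set c : C(I, ℂ) := concatCM (piecesCM z q u).1.1 (piecesCM z q u).2.1 with hc
  have hclosed : c 0 = c 1 := concatCM_piecesCM_closed z q u
  rw [show unrootCM c = Curve.unroot ⟨Curve.mk c, hclosed⟩ from dif_pos hclosed, unrooted]
  -- `Curve.mk c` is a monotone reparametrisation of `rooted (z, q)`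
  have hV : ContinuousOn (fun x : ℝ ↦ rootedFun (z, q) (projIcc 0 1 zero_le_one x)) (Icc 0 1) :=
    ((continuous_rootedFun _).comp continuous_projIcc).continuousOn
  have hdist : Curve.reparamDist (Curve.mk c) (rooted (z, q)) = 0 := by
    refine Curve.reparamDist_eq_zero_of_monotone' zero_le_one hV (continuous_fracChange u)
      continuous_id (monotone_fracChange u) monotone_id ?_ rfl ?_ rfl ?_ ?_
    · simp [fracChange]
    · simp only [fracChange]
      rw [if_neg (by norm_num)]
      ring
    · intro t
      show c t = rootedFun (z, q) (projIcc 0 1 zero_le_one (fracChange u t))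
      rw [hc, concatCM_apply_of_eq (piecesCM_junction z q u)]
      simp only [fracChange]
      split_ifs with ht
      · show rootedFun (z, q) (fstTime u (dbl₁ t)) = _
        congr 1
        apply Subtype.ext
        have h2t : (dbl₁ t : ℝ) = 2 * t := coe_dbl₁ ht
        have hm : (u : ℝ) * (2 * t) ∈ Icc (0 : ℝ) 1 :=
          ⟨by nlinarith [u.2.1, t.2.1], by nlinarith [u.2.2, u.2.1, t.2.1]⟩
        rw [coe_fstTime, h2t, projIcc_of_mem _ hm]
      · show rootedFun (z, q) (sndTime u (dbl₂ t)) = _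
        congr 1
        apply Subtype.ext
        have h2t : (dbl₂ t : ℝ) = 2 * t - 1 := coe_dbl₂ (le_of_lt (not_le.1 ht))
        have hm : (u : ℝ) + (1 - u) * (2 * t - 1) ∈ Icc (0 : ℝ) 1 :=
          ⟨by nlinarith [u.2.1, u.2.2, t.2.1, not_le.1 ht], by nlinarith [u.2.2, u.2.1, t.2.2]⟩
        rw [coe_sndTime, h2t, projIcc_of_mem _ hm]
    · intro t
      show rootedFun (z, q) t = rootedFun (z, q) (projIcc 0 1 zero_le_one (id (t : ℝ)))
      rw [id, projIcc_val]
  have hcl : CurveClass.mk (Curve.mk c) = CurveClass.mk (rooted (z, q)) := CurveClass.mk_eq_mk.2 hdist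
  simp only [Curve.unroot]
  congr 1
  exact Subtype.ext hcl

/-- **The trace of the rooted loop is the union of the traces of its two pieces.** [folklore] -/
theorem range_rooted_eq_union (u : I) :
    (rooted (z, q)).range = range ((piecesCM z q u).1.1) ∪ range ((piecesCM z q u).2.1) := by
  rw [← range_concatCM (piecesCM_junction z q u)]
  have h := congrArg UnbasedLoop.range (unrootCM_concatCM_piecesCM z q u)
  rw [show unrootCM (concatCM (piecesCM z q u).1.1 (piecesCM z q u).2.1) = Curve.unroot
    ⟨Curve.mk _, concatCM_piecesCM_closed z q u⟩ from dif_pos (concatCM_piecesCM_closed z q u),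
    unrooted, Curve.range_unroot, Curve.range_unroot] at h
  exact h.symm

/-! ### Additivity of the conformal clock -/

variable {D D' : Set ℂ}

/-- **The conformal clock is additive over the two pieces**: for a loop in `D`,
`t ∫₀¹|f'(γ)|² = (tu) ∫₀¹|f'(piece₁)|² + (t(1−u)) ∫₀¹|f'(piece₂)|²` ([Lawler] §5.1,
`t_{f∘(γ⊕γ')} = t_{f∘γ} + t_{f∘γ'}`). [cite: Lawler2005ConformallyInvariant, §5.1] -/
theorem clock_pieces (hD : IsOpen D) (f : ConformalEquiv D D') (hγ : (rooted (z, q)).range ⊆ D)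
    (u : I) (h0 : 0 < (u : ℝ)) (h1 : (u : ℝ) < 1) :
    q.1 * clockIntegral f (rooted (z, q)).toContinuousMap =
      q.1 * u * clockIntegral f (piecesCM z q u).1.1 +
        q.1 * (1 - u) * clockIntegral f (piecesCM z q u).2.1 := by
  set φ : ℝ → ℝ := fun x ↦ ‖deriv f (IccExtend zero_le_one (rooted (z, q)).toContinuousMap x)‖ ^ 2
    with hφ
  obtain ⟨hc, -⟩ := continuous_pos_deriv_comp hD f (γ := (rooted (z, q)).toContinuousMap) hγ
  have hI : clockIntegral f (rooted (z, q)).toContinuousMap = ∫ x in (0 : ℝ)..1, φ x :=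
    clockIntegral_eq f _
  -- first piece: `∫₀¹ |f'(piece₁)|² = u⁻¹ ∫₀ᵘ φ`
  have hP1 : clockIntegral f (piecesCM z q u).1.1 = (u : ℝ)⁻¹ * ∫ x in (0 : ℝ)..u, φ x := by
    rw [clockIntegral_eq]
    have e : ∀ x ∈ uIcc (0 : ℝ) 1, ‖deriv f (IccExtend zero_le_one ((piecesCM z q u).1.1) x)‖ ^ 2 =
        φ ((u : ℝ) * x) := by
      intro x hx
      rw [uIcc_of_le zero_le_one] at hx
      simp only [hφ]
      congr 3
      rw [IccExtend_of_mem _ _ hx, IccExtend_of_mem _ _ ⟨by nlinarith [u.2.1, hx.1],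
        by nlinarith [u.2.2, u.2.1, hx.2, hx.1]⟩]
      show rootedFun (z, q) (fstTime u ⟨x, hx⟩) = rootedFun (z, q) _
      rfl
    rw [intervalIntegral.integral_congr e, intervalIntegral.integral_comp_mul_left _ h0.ne',
      mul_zero, mul_one, smul_eq_mul]
  -- second piece: `∫₀¹ |f'(piece₂)|² = (1−u)⁻¹ ∫ᵤ¹ φ`
  have hP2 : clockIntegral f (piecesCM z q u).2.1 = (1 - (u : ℝ))⁻¹ * ∫ x in (u : ℝ)..1, φ x := by
    rw [clockIntegral_eq]
    have h1u : 0 < 1 - (u : ℝ) := by linarith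
    have e : ∀ x ∈ uIcc (0 : ℝ) 1, ‖deriv f (IccExtend zero_le_one ((piecesCM z q u).2.1) x)‖ ^ 2 =
        φ ((1 - (u : ℝ)) * x + u) := by
      intro x hx
      rw [uIcc_of_le zero_le_one] at hx
      simp only [hφ]
      congr 3
      rw [IccExtend_of_mem _ _ hx, IccExtend_of_mem _ _ ⟨by nlinarith [u.2.1, hx.1],
        by nlinarith [u.2.2, hx.2, hx.1]⟩]
      show rootedFun (z, q) (sndTime u ⟨x, hx⟩) = rootedFun (z, q) _
      congr 1
      exact Subtype.ext (by rw [coe_sndTime]; ring)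
    rw [intervalIntegral.integral_congr e, intervalIntegral.integral_comp_mul_add _ h1u.ne',
      mul_zero, zero_add, mul_one, show (1 - (u : ℝ)) + u = 1 by ring, smul_eq_mul]
  rw [hI, hP1, hP2, ← intervalIntegral.integral_add_adjacent_intervals
    (hc.intervalIntegrable 0 u) (hc.intervalIntegrable u 1)]
  have hu0 : (u : ℝ) ≠ 0 := h0.ne'
  have hu1 : 1 - (u : ℝ) ≠ 0 := by linarith
  field_simp
  ring

/-! ### The mark weight -/

/-- **`∫₀¹ |f'(γ(r))|² dr / ∫₀¹|f'(γ)|² = 1`** for a loop in `D` (the density, with respect to the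
uniform mark, of a mark distributed proportionally to the conformal clock). [folklore] -/
theorem lintegral_markWeight (hD : IsOpen D) (f : ConformalEquiv D D') {γ : C(I, ℂ)}
    (hγ : range γ ⊆ D) :
    ∫⁻ r : I, ENNReal.ofReal (‖deriv f (γ r)‖ ^ 2) / ENNReal.ofReal (clockIntegral f γ) = 1 := by
  have hpos := clockIntegral_pos hD f hγ
  obtain ⟨hc, -⟩ := continuous_pos_deriv_comp hD f hγ
  have hcont : Continuous fun r : I ↦ ‖deriv f (γ r)‖ ^ 2 := by
    have := hc.comp (continuous_subtype_val : Continuous ((↑) : I → ℝ))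
    simpa only [Function.comp_def, IccExtend_val] using this
  have hint : Integrable (fun r : I ↦ ‖deriv f (γ r)‖ ^ 2) volume :=
    hcont.integrable_of_hasCompactSupport (HasCompactSupport.of_compactSpace _)
  have hm : Measurable fun r : I ↦ ENNReal.ofReal (‖deriv f (γ r)‖ ^ 2) :=
    ENNReal.measurable_ofReal.comp hcont.measurable
  simp_rw [div_eq_mul_inv]
  rw [lintegral_mul_const _ hm,
    ← ofReal_integral_eq_lintegral_ofReal hint (Filter.Eventually.of_forall fun r ↦ sq_nonneg _),
    ← clockIntegral, ENNReal.mul_inv_cancel ((ENNReal.ofReal_pos.2 hpos).ne') ENNReal.ofReal_ne_top]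

end BrownianLoop

end Literature.Probability.RandomPlanarGeometry

end

/-!
# Images and reparametrisation classes of the pieces of a Brownian loop

Lawler, *Conformally Invariant Processes in the Plane* (2005), §5.1: the image `f ∘ γ` of a path
under a conformal map is considered in its own (time-changed) parametrisation,
`t_{f∘γ} = ∫₀^{t_γ} |f'(γ(s))|² ds`; conformal invariance statements for path measures
([Lawler] Prop. 5.5, "`f ∘ μ_D(z, w) = μ_{D'}(f(z), f(w))`") are therefore statements about
paths *modulo increasing reparametrisation* — the tree's `CurveClass ℂ`
(`CurveSpace`: `SeparationQuotient (Curve ℂ)` for the reparametrisation pseudo-metric of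
Aizenman–Burchard (1999), §2.1). This file provides the (small) interface between the
parametrised pieces of a Brownian loop on `C([0,1], ℂ)` (`concatCM`, `unrootCM`, images) and
curve classes:

* `imCM f D γ` — the image of a continuous path lying in `D` (as a continuous path on `[0,1]`),
  `measurable_imCM`, `imCM_concatCM`, `imageOn_unrootCM`;
* `mkCM γ` — the class of a continuous path; `glue φ ψ` — two increasing reparametrisations of
  `[0,1]` glued at `1/2`, with `concatCM_glue` (reparametrising a concatenation piecewise);
  `dist_concatCM_le` — **concatenation is `3`-Lipschitz for the reparametrisation distance** and
  respects distance zero, so that it DESCENDS to classes: `concatClass`, `mkCM_concatCM`;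
* `unrootClass` — the unbased loop of a curve class (`unrootCM` factors through `mkCM`:
  `unrootCM_eq_unrootClass`), `measurable_unrootClass`, `measurable_concatClass`.

## References

* G. F. Lawler, *Conformally Invariant Processes in the Plane*, AMS (2005), §5.1.
* M. Aizenman, A. Burchard, Duke Math. J. 99 (1999), §2.1 (curves modulo reparametrisation).
-/

noncomputable section

open Set MeasureTheory unitInterval Function
open scoped unitInterval NNReal ENNReal

namespace Literature.Probability.RandomPlanarGeometry

open Literature.Probability.Process (WienerPair wienerPair)
open UnbasedLoop

namespace BrownianLoop

variable {D D' : Set ℂ}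

/-! ### Images of continuous paths -/

/-- The image `f ∘ γ` of a continuous path lying in `D`, `f` continuous on `D` (junk `γ`
otherwise), as a continuous path: `Curve.imageOn` on `C([0,1], ℂ)`. [folklore] -/
def imCM (f : ℂ → ℂ) (D : Set ℂ) (γ : C(I, ℂ)) : C(I, ℂ) := ((Curve.mk γ).imageOn f D).toContinuousMap

/-- Pointwise formula. [folklore] -/
theorem imCM_apply {f : ℂ → ℂ} (hf : ContinuousOn f D) {γ : C(I, ℂ)} (hγ : range γ ⊆ D) (r : I) :
    imCM f D γ r = f (γ r) :=
  Curve.imageOn_apply hf (γ := Curve.mk γ) hγ r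

/-- The junk case. [folklore] -/
theorem imCM_of_not {f : ℂ → ℂ} {γ : C(I, ℂ)} (h : ¬ (ContinuousOn f D ∧ range γ ⊆ D)) :
    imCM f D γ = γ := by
  rw [imCM, Curve.imageOn_of_not (γ := Curve.mk γ) h]

open Classical in
/-- Pointwise formula with the junk case. [folklore] -/
theorem imCM_apply_eq (f : ℂ → ℂ) (D : Set ℂ) (γ : C(I, ℂ)) (r : I) :
    imCM f D γ r = if ContinuousOn f D ∧ range γ ⊆ D then f (γ r) else γ r := by
  split_ifs with h
  · exact imCM_apply h.1 h.2 r
  · rw [imCM_of_not h]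

/-- The image path lies in `f(D)`. [folklore] -/
theorem range_imCM {f : ℂ → ℂ} (hf : ContinuousOn f D) {γ : C(I, ℂ)} (hγ : range γ ⊆ D) :
    range (imCM f D γ) = f '' range γ := by
  ext x
  simp only [mem_range, imCM_apply hf hγ, mem_image]
  constructor
  · rintro ⟨r, rfl⟩; exact ⟨γ r, ⟨r, rfl⟩, rfl⟩
  · rintro ⟨_, ⟨r, rfl⟩, rfl⟩; exact ⟨r, rfl⟩

/-- **The image of the unbased loop of a closed path in `D` is the unbased loop of its image
path.** [folklore] -/
theorem imageOn_unrootCM {f : ℂ → ℂ} (hf : ContinuousOn f D) {γ : C(I, ℂ)} (hγ : range γ ⊆ D)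
    (hc : γ 0 = γ 1) : imageOn f D (unrootCM γ) = unrootCM (imCM f D γ) := by
  have hc' : imCM f D γ 0 = imCM f D γ 1 := by rw [imCM_apply hf hγ, imCM_apply hf hγ, hc]
  rw [show unrootCM γ = Curve.unroot ⟨Curve.mk γ, hc⟩ from dif_pos hc,
    show unrootCM (imCM f D γ) = Curve.unroot ⟨Curve.mk (imCM f D γ), hc'⟩ from dif_pos hc',
    imageOn_unroot]
  rfl

/-- **The image of a concatenation is the concatenation of the images** (matching endpoints,
both pieces in `D`). [folklore] -/
theorem imCM_concatCM {f : ℂ → ℂ} (hf : ContinuousOn f D) {a b : C(I, ℂ)} (h : a 1 = b 0)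
    (ha : range a ⊆ D) (hb : range b ⊆ D) :
    imCM f D (concatCM a b) = concatCM (imCM f D a) (imCM f D b) := by
  have hab : range (concatCM a b) ⊆ D := by rw [range_concatCM h]; exact union_subset ha hb
  have h' : imCM f D a 1 = imCM f D b 0 := by rw [imCM_apply hf ha, imCM_apply hf hb, h]
  ext1 r
  rw [imCM_apply hf hab, concatCM_apply_of_eq h, concatCM_apply_of_eq h']
  split_ifs
  · rw [imCM_apply hf ha]
  · rw [imCM_apply hf hb]

/-- The set of continuous paths lying in an open set is open (hence Borel). This is Mathlib's
`ContinuousMap.isOpen_setOf_range_subset`; kept only as a deprecated alias. [folklore] -/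
@[deprecated ContinuousMap.isOpen_setOf_range_subset (since := "2026-08-16")]
theorem isOpen_setOf_range_subset (hD : IsOpen D) : IsOpen {γ : C(I, ℂ) | range γ ⊆ D} :=
  ContinuousMap.isOpen_setOf_range_subset hD

section Measurable

variable [MeasurableSpace C(I, ℂ)] [BorelSpace C(I, ℂ)]

/-- `imCM f D` is measurable on `C([0,1], ℂ)` for open `D` (whatever `f` is off `D`).
[folklore] -/
theorem measurable_imCM (f : ℂ → ℂ) (hD : IsOpen D) : Measurable (imCM f D) := by
  classical
  by_cases hf : ContinuousOn f D
  · refine measurable_of_eval fun r ↦ ?_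
    set S : Set C(I, ℂ) := {γ | range γ ⊆ D} with hS
    have heq : (fun γ : C(I, ℂ) ↦ imCM f D γ r) = fun γ : C(I, ℂ) ↦
        if h : γ ∈ S then D.restrict f ⟨γ r, h ⟨r, rfl⟩⟩ else γ r := by
      funext γ
      rw [imCM_apply_eq]
      by_cases h : γ ∈ S
      · rw [if_pos ⟨hf, h⟩, dif_pos h]; rfl
      · rw [if_neg (fun h' ↦ h h'.2), dif_neg h]
    rw [heq]
    have hc : Continuous fun γ : S ↦ (⟨(γ : C(I, ℂ)) r, γ.2 ⟨r, rfl⟩⟩ : D) :=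
      ((continuous_eval_const r).comp continuous_subtype_val).subtype_mk _
    have h1 : Measurable fun γ : S ↦ D.restrict f ⟨(γ : C(I, ℂ)) r, γ.2 ⟨r, rfl⟩⟩ :=
      (hf.restrict.comp hc).measurable
    have h2 : Measurable fun γ : (Sᶜ : Set C(I, ℂ)) ↦ (γ : C(I, ℂ)) r :=
      (measurable_eval_continuousMap r).comp measurable_subtype_coe
    exact Measurable.dite h1 h2 (ContinuousMap.isOpen_setOf_range_subset hD).measurableSet
  · have : imCM f D = id := funext fun γ ↦ imCM_of_not fun h ↦ hf h.1
    rw [this]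
    exact measurable_id

/-- `{q | the bridge from a to b lies in D}` is measurable. [folklore] -/
theorem measurableSet_bridge_subset (hD : IsOpen D) (a b : ℂ) :
    MeasurableSet {q : ℝ × WienerPair | range (bridgeFun a b q) ⊆ D} := by
  have h : Measurable fun q : ℝ × WienerPair ↦ bridgeFunCM a b q :=
    measurable_bridgeFunCM.comp (measurable_const.prodMk (measurable_const.prodMk measurable_id))
  exact (ContinuousMap.isOpen_setOf_range_subset hD).measurableSet.preimage h

end Measurable

/-! ### Classes of continuous paths modulo increasing reparametrisation -/

/-- The class of a continuous path on `[0,1]` modulo increasing reparametrisation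
(`CurveClass.mk ∘ Curve.mk`; Aizenman–Burchard (1999), §2.1). [folklore] -/
def mkCM (γ : C(I, ℂ)) : CurveClass ℂ := CurveClass.mk (Curve.mk γ)

/-- Two paths have the same class iff their reparametrisation distance vanishes. [folklore] -/
theorem mkCM_eq_mkCM_iff {γ γ' : C(I, ℂ)} :
    mkCM γ = mkCM γ' ↔ dist (Curve.mk γ) (Curve.mk γ') = 0 :=
  CurveClass.mk_eq_mk_iff_dist_eq_zero

/-- The distance of classes is the reparametrisation distance. [folklore] -/
theorem dist_mkCM (γ γ' : C(I, ℂ)) : dist (mkCM γ) (mkCM γ') = dist (Curve.mk γ) (Curve.mk γ') :=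
  rfl

/-- `mkCM` is `1`-Lipschitz from the sup distance. [folklore] -/
theorem lipschitzWith_mkCM : LipschitzWith 1 mkCM :=
  LipschitzWith.mk_one fun γ γ' ↦ by
    rw [dist_mkCM]
    exact Curve.dist_le_dist_toContinuousMap (Curve.mk γ) (Curve.mk γ')

/-- `mkCM` is continuous. [folklore] -/
@[fun_prop] theorem continuous_mkCM : Continuous mkCM := lipschitzWith_mkCM.continuous

/-- Paths with the same class start at the same point. [folklore] -/
theorem apply_zero_eq_of_mkCM_eq {γ γ' : C(I, ℂ)} (h : mkCM γ = mkCM γ') : γ 0 = γ' 0 :=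
  Curve.source_eq_of_dist_eq_zero (mkCM_eq_mkCM_iff.1 h)

/-- Paths with the same class end at the same point. [folklore] -/
theorem apply_one_eq_of_mkCM_eq {γ γ' : C(I, ℂ)} (h : mkCM γ = mkCM γ') : γ 1 = γ' 1 :=
  Curve.target_eq_of_dist_eq_zero (mkCM_eq_mkCM_iff.1 h)

section MeasurableMk

variable [MeasurableSpace C(I, ℂ)] [BorelSpace C(I, ℂ)]

/-- `mkCM` is measurable. [folklore] -/
theorem measurable_mkCM : Measurable mkCM := continuous_mkCM.measurable

end MeasurableMk

/-! ### Gluing two increasing reparametrisations of `[0,1]` at `1/2` -/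

/-- `x ↦ x / 2` on `[0,1]`. [folklore] -/
def halfL (x : I) : I := ⟨x / 2, by constructor <;> linarith [x.2.1, x.2.2]⟩

/-- `x ↦ (1 + x) / 2` on `[0,1]`. [folklore] -/
def halfR (x : I) : I := ⟨(1 + x) / 2, by constructor <;> linarith [x.2.1, x.2.2]⟩

/-- Value of `halfL`. [folklore] -/
@[simp] theorem coe_halfL (x : I) : (halfL x : ℝ) = x / 2 := rfl

/-- Value of `halfR`. [folklore] -/
@[simp] theorem coe_halfR (x : I) : (halfR x : ℝ) = (1 + x) / 2 := rfl

/-- An increasing reparametrisation fixes `0`. [folklore] -/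
@[simp] theorem orderIso_zero (φ : I ≃o I) : φ 0 = 0 := φ.map_bot

/-- An increasing reparametrisation fixes `1`. [folklore] -/
@[simp] theorem orderIso_one (φ : I ≃o I) : φ 1 = 1 := φ.map_top

/-- An increasing reparametrisation is positive at positive times. [folklore] -/
theorem orderIso_pos (φ : I ≃o I) {x : I} (hx : 0 < x) : 0 < φ x := by
  rw [← orderIso_zero φ]; exact φ.strictMono hx

variable (φ ψ : I ≃o I)

/-- Two increasing reparametrisations `φ, ψ` of `[0,1]` glued at `1/2`: `φ` rescaled to
`[0, 1/2]` and `ψ` rescaled to `[1/2, 1]` (as a function). [folklore] -/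
def glueFun (r : I) : I := if (r : ℝ) ≤ 1 / 2 then halfL (φ (dbl₁ r)) else halfR (ψ (dbl₂ r))

/-- Value of `glueFun` on the first half. [folklore] -/
theorem coe_glueFun_of_le {r : I} (hr : (r : ℝ) ≤ 1 / 2) :
    (glueFun φ ψ r : ℝ) = φ (dbl₁ r) / 2 := by
  rw [glueFun, if_pos hr]; rfl

/-- Value of `glueFun` on the second half. [folklore] -/
theorem coe_glueFun_of_lt {r : I} (hr : 1 / 2 < (r : ℝ)) :
    (glueFun φ ψ r : ℝ) = (1 + ψ (dbl₂ r)) / 2 := by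
  rw [glueFun, if_neg (not_le.2 hr)]; rfl

/-- `glueFun` maps the first half into the first half. [folklore] -/
theorem glueFun_le_half {r : I} (hr : (r : ℝ) ≤ 1 / 2) : (glueFun φ ψ r : ℝ) ≤ 1 / 2 := by
  rw [coe_glueFun_of_le φ ψ hr]; linarith [(φ (dbl₁ r)).2.2]

/-- `glueFun` maps the open second half into the open second half. [folklore] -/
theorem half_lt_glueFun {r : I} (hr : 1 / 2 < (r : ℝ)) : 1 / 2 < (glueFun φ ψ r : ℝ) := by
  rw [coe_glueFun_of_lt φ ψ hr]
  have h0 : (0 : I) < dbl₂ r := by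
    show ((0 : I) : ℝ) < (dbl₂ r : ℝ)
    rw [coe_dbl₂ hr.le]; norm_num; linarith
  have : (0 : ℝ) < (ψ (dbl₂ r) : ℝ) := unitInterval.coe_pos.2 (orderIso_pos ψ h0)
  linarith

/-- `glueFun` is strictly increasing. [folklore] -/
theorem strictMono_glueFun : StrictMono (glueFun φ ψ) := by
  intro r s hrs
  have hrs' : (r : ℝ) < s := hrs
  show (glueFun φ ψ r : ℝ) < glueFun φ ψ s
  by_cases hs : (s : ℝ) ≤ 1 / 2
  · have hr : (r : ℝ) ≤ 1 / 2 := by linarith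
    rw [coe_glueFun_of_le φ ψ hr, coe_glueFun_of_le φ ψ hs]
    have h1 : dbl₁ r < dbl₁ s := by
      show (dbl₁ r : ℝ) < dbl₁ s
      rw [coe_dbl₁ hr, coe_dbl₁ hs]; linarith
    have h2 : (φ (dbl₁ r) : ℝ) < φ (dbl₁ s) := Subtype.coe_lt_coe.2 (φ.strictMono h1)
    linarith
  · rw [not_le] at hs
    by_cases hr : (r : ℝ) ≤ 1 / 2
    · exact lt_of_le_of_lt (glueFun_le_half φ ψ hr) (half_lt_glueFun φ ψ hs)
    · rw [not_le] at hr
      rw [coe_glueFun_of_lt φ ψ hr, coe_glueFun_of_lt φ ψ hs]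
      have h1 : dbl₂ r < dbl₂ s := by
        show (dbl₂ r : ℝ) < dbl₂ s
        rw [coe_dbl₂ hr.le, coe_dbl₂ hs.le]; linarith
      have h2 : (ψ (dbl₂ r) : ℝ) < ψ (dbl₂ s) := Subtype.coe_lt_coe.2 (ψ.strictMono h1)
      linarith

/-- `glueFun` is onto. [folklore] -/
theorem surjective_glueFun : Surjective (glueFun φ ψ) := by
  intro y
  by_cases hy : (y : ℝ) ≤ 1 / 2
  · set x : I := ⟨2 * y, by constructor <;> linarith [y.2.1]⟩ with hx
    refine ⟨halfL (φ.symm x), ?_⟩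
    have hr : ((halfL (φ.symm x) : I) : ℝ) ≤ 1 / 2 := by
      rw [coe_halfL]; linarith [(φ.symm x).2.2]
    apply Subtype.ext
    rw [coe_glueFun_of_le φ ψ hr]
    have hd : dbl₁ (halfL (φ.symm x)) = φ.symm x :=
      Subtype.ext (by rw [coe_dbl₁ hr, coe_halfL]; ring)
    rw [hd, OrderIso.apply_symm_apply]
    show 2 * (y : ℝ) / 2 = y
    ring
  · rw [not_le] at hy
    set x : I := ⟨2 * y - 1, by constructor <;> linarith [y.2.2]⟩ with hx
    have hx0 : (0 : I) < x := unitInterval.coe_pos.1 (by show (0 : ℝ) < 2 * (y : ℝ) - 1; linarith)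
    refine ⟨halfR (ψ.symm x), ?_⟩
    have hpos : (0 : ℝ) < (ψ.symm x : ℝ) := unitInterval.coe_pos.2 (orderIso_pos ψ.symm hx0)
    have hr : 1 / 2 < ((halfR (ψ.symm x) : I) : ℝ) := by rw [coe_halfR]; linarith
    apply Subtype.ext
    rw [coe_glueFun_of_lt φ ψ hr]
    have hd : dbl₂ (halfR (ψ.symm x)) = ψ.symm x :=
      Subtype.ext (by rw [coe_dbl₂ hr.le, coe_halfR]; ring)
    rw [hd, OrderIso.apply_symm_apply]
    show (1 + (2 * (y : ℝ) - 1)) / 2 = y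
    ring

/-- **The glued reparametrisation** `glue φ ψ : [0,1] ≃o [0,1]`. [folklore] -/
def glue : I ≃o I :=
  StrictMono.orderIsoOfSurjective (glueFun φ ψ) (strictMono_glueFun φ ψ) (surjective_glueFun φ ψ)

/-- `glue` is `glueFun`. [folklore] -/
@[simp] theorem glue_apply (r : I) : glue φ ψ r = glueFun φ ψ r := rfl

/-- **Reparametrising a concatenation by a glued reparametrisation reparametrises the pieces.**
[folklore] -/
theorem concatCM_glue (a b : C(I, ℂ)) (r : I) :
    concatCM a b (glue φ ψ r) =
      concatCM (a.comp φ.toContinuousMapUnitInterval) (b.comp ψ.toContinuousMapUnitInterval) r := by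
  rw [glue_apply, concatCM_apply, concatCM_apply]
  simp only [ContinuousMap.comp_apply, OrderIso.toContinuousMapUnitInterval_apply, orderIso_one,
    orderIso_zero]
  by_cases hr : (r : ℝ) ≤ 1 / 2
  · rw [if_pos (glueFun_le_half φ ψ hr), if_pos hr]
    congr 1
    exact Subtype.ext (by rw [coe_dbl₁ (glueFun_le_half φ ψ hr), coe_glueFun_of_le φ ψ hr]; ring)
  · rw [not_le] at hr
    rw [if_neg (not_le.2 (half_lt_glueFun φ ψ hr)), if_neg (not_le.2 hr)]
    congr 2
    exact Subtype.ext (by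
      rw [coe_dbl₂ (half_lt_glueFun φ ψ hr).le, coe_glueFun_of_lt φ ψ hr]; ring)

/-- Pointwise comparison of two concatenations along a glued reparametrisation. [folklore] -/
theorem dist_concatCM_apply_glue_le (a a' b b' : C(I, ℂ)) (r : I) :
    dist (concatCM a b r) (concatCM a' b' (glue φ ψ r)) ≤
      max (dist a (a'.comp φ.toContinuousMapUnitInterval))
          (dist b (b'.comp ψ.toContinuousMapUnitInterval)) +
        (dist (a 1) (a' 1) + dist (b 0) (b' 0)) := by
  rw [concatCM_glue, concatCM_apply, concatCM_apply]
  simp only [ContinuousMap.comp_apply, OrderIso.toContinuousMapUnitInterval_apply, orderIso_one,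
    orderIso_zero]
  have hnn : 0 ≤ dist (a 1) (a' 1) + dist (b 0) (b' 0) := by positivity
  split_ifs with hr
  · calc dist (a (dbl₁ r)) (a' (φ (dbl₁ r)))
        ≤ dist a (a'.comp φ.toContinuousMapUnitInterval) :=
          ContinuousMap.dist_apply_le_dist (f := a) (g := a'.comp φ.toContinuousMapUnitInterval)
            (dbl₁ r)
      _ ≤ _ := (le_max_left _ _).trans (le_add_of_nonneg_right hnn)
  · have h1 : dist (b (dbl₂ r) + (a 1 - b 0)) (b' (ψ (dbl₂ r)) + (a' 1 - b' 0)) ≤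
        dist (b (dbl₂ r)) (b' (ψ (dbl₂ r))) + (dist (a 1) (a' 1) + dist (b 0) (b' 0)) := by
      simp only [dist_eq_norm]
      have : b (dbl₂ r) + (a 1 - b 0) - (b' (ψ (dbl₂ r)) + (a' 1 - b' 0)) =
          (b (dbl₂ r) - b' (ψ (dbl₂ r))) + ((a 1 - a' 1) - (b 0 - b' 0)) := by ring
      rw [this]
      exact (norm_add_le _ _).trans (add_le_add le_rfl (norm_sub_le _ _))
    refine h1.trans (add_le_add ?_ le_rfl)
    exact (ContinuousMap.dist_apply_le_dist (f := b) (g := b'.comp ψ.toContinuousMapUnitInterval)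
      (dbl₂ r)).trans (le_max_right _ _)

/-- **Concatenation is Lipschitz for the reparametrisation distance**:
`d(a ⊕ b, a' ⊕ b') ≤ max(d(a,a'), d(b,b')) + |a(1) − a'(1)| + |b(0) − b'(0)|`. [folklore] -/
theorem dist_concatCM_le (a a' b b' : C(I, ℂ)) :
    dist (Curve.mk (concatCM a b)) (Curve.mk (concatCM a' b')) ≤
      max (dist (Curve.mk a) (Curve.mk a')) (dist (Curve.mk b) (Curve.mk b')) +
        (dist (a 1) (a' 1) + dist (b 0) (b' 0)) := by
  set m : ℝ := max (dist (Curve.mk a) (Curve.mk a')) (dist (Curve.mk b) (Curve.mk b')) with hm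
  set e : ℝ := dist (a 1) (a' 1) + dist (b 0) (b' 0) with he
  have he0 : 0 ≤ e := by positivity
  have hm0 : 0 ≤ m := by rw [hm]; positivity
  refine le_of_forall_gt_imp_ge_of_dense fun c hc ↦ ?_
  have hc' : m < c - e := by linarith
  obtain ⟨φ, hφ⟩ := Curve.exists_dist_reparam_lt (γ₁ := Curve.mk a) (γ₂ := Curve.mk a')
    (lt_of_le_of_lt (le_max_left _ _) hc')
  obtain ⟨ψ, hψ⟩ := Curve.exists_dist_reparam_lt (γ₁ := Curve.mk b) (γ₂ := Curve.mk b')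
    (lt_of_le_of_lt (le_max_right _ _) hc')
  calc dist (Curve.mk (concatCM a b)) (Curve.mk (concatCM a' b'))
      ≤ dist (Curve.mk (concatCM a b)).toContinuousMap
          ((Curve.mk (concatCM a' b')).reparam (glue φ ψ)).toContinuousMap :=
        Curve.reparamDist_le _ _ _
    _ ≤ (c - e) + e := by
        refine (ContinuousMap.dist_le (by linarith)).2 fun r ↦ ?_
        refine (dist_concatCM_apply_glue_le φ ψ a a' b b' r).trans ?_
        gcongr
        exact max_le hφ.le hψ.le
    _ = c := by ring

/-- Concatenation respects reparametrisation distance zero. [folklore] -/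
theorem dist_concatCM_eq_zero {a a' b b' : C(I, ℂ)} (ha : dist (Curve.mk a) (Curve.mk a') = 0)
    (hb : dist (Curve.mk b) (Curve.mk b') = 0) :
    dist (Curve.mk (concatCM a b)) (Curve.mk (concatCM a' b')) = 0 := by
  refine le_antisymm ?_ dist_nonneg
  have h1 : a 1 = a' 1 := Curve.target_eq_of_dist_eq_zero ha
  have h0 : b 0 = b' 0 := Curve.source_eq_of_dist_eq_zero hb
  have := dist_concatCM_le a a' b b'
  rwa [ha, hb, h1, h0, max_self, dist_self, dist_self, add_zero, add_zero] at this

/-- **Concatenation of curve classes** (at the fraction `1/2`, the second piece translated to the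
end of the first): `concatCM` descends to `CurveClass ℂ`. [folklore] -/
def concatClass : CurveClass ℂ → CurveClass ℂ → CurveClass ℂ :=
  SeparationQuotient.lift₂
    (fun γ γ' : Curve ℂ ↦ mkCM (concatCM γ.toContinuousMap γ'.toContinuousMap))
    fun _ _ _ _ hac hbd ↦ mkCM_eq_mkCM_iff.2
      (dist_concatCM_eq_zero (Metric.inseparable_iff.1 hac) (Metric.inseparable_iff.1 hbd))

/-- `concatClass` on classes of curves. [folklore] -/
@[simp] theorem concatClass_mk_mk (γ γ' : Curve ℂ) :
    concatClass (CurveClass.mk γ) (CurveClass.mk γ') =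
      mkCM (concatCM γ.toContinuousMap γ'.toContinuousMap) := rfl

/-- **The class of a concatenation is the concatenation of the classes.** [folklore] -/
theorem mkCM_concatCM (a b : C(I, ℂ)) : mkCM (concatCM a b) = concatClass (mkCM a) (mkCM b) := rfl

/-- `concatClass` is `3`-Lipschitz in each pair of arguments. [folklore] -/
theorem dist_concatClass_le (c₁ c₂ c₁' c₂' : CurveClass ℂ) :
    dist (concatClass c₁ c₂) (concatClass c₁' c₂') ≤ 3 * max (dist c₁ c₁') (dist c₂ c₂') := by
  obtain ⟨a, rfl⟩ := CurveClass.surjective_mk c₁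
  obtain ⟨b, rfl⟩ := CurveClass.surjective_mk c₂
  obtain ⟨a', rfl⟩ := CurveClass.surjective_mk c₁'
  obtain ⟨b', rfl⟩ := CurveClass.surjective_mk c₂'
  rw [concatClass_mk_mk, concatClass_mk_mk, dist_mkCM]
  have ea : dist (CurveClass.mk a) (CurveClass.mk a') = dist a a' := rfl
  have eb : dist (CurveClass.mk b) (CurveClass.mk b') = dist b b' := rfl
  rw [ea, eb]
  have h1 : dist (a.toContinuousMap 1) (a'.toContinuousMap 1) ≤ dist a a' := Curve.dist_target_le a a'
  have h0 : dist (b.toContinuousMap 0) (b'.toContinuousMap 0) ≤ dist b b' := Curve.dist_source_le b b'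
  calc dist (Curve.mk (concatCM a.toContinuousMap b.toContinuousMap))
        (Curve.mk (concatCM a'.toContinuousMap b'.toContinuousMap))
      ≤ max (dist a a') (dist b b') +
          (dist (a.toContinuousMap 1) (a'.toContinuousMap 1) +
            dist (b.toContinuousMap 0) (b'.toContinuousMap 0)) := dist_concatCM_le _ _ _ _
    _ ≤ max (dist a a') (dist b b') + (max (dist a a') (dist b b') + max (dist a a') (dist b b')) := by
        gcongr
        · exact h1.trans (le_max_left _ _)
        · exact h0.trans (le_max_right _ _)
    _ = 3 * max (dist a a') (dist b b') := by ring

/-- `concatClass` is continuous (jointly). [folklore] -/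
theorem continuous_concatClass : Continuous fun p : CurveClass ℂ × CurveClass ℂ ↦ concatClass p.1 p.2 := by
  refine (LipschitzWith.of_dist_le_mul (K := 3) fun p q ↦ ?_).continuous
  rw [Prod.dist_eq, NNReal.coe_ofNat]
  exact dist_concatClass_le p.1 p.2 q.1 q.2

/-- `concatClass` is measurable (jointly). [folklore] -/
theorem measurable_concatClass : Measurable fun p : CurveClass ℂ × CurveClass ℂ ↦ concatClass p.1 p.2 :=
  continuous_concatClass.measurable

/-! ### The unbased loop of a curve class -/

/-- The unbased loop of a curve class (junk: the constant loop at its starting point when the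
class is not closed), so that `unrootCM = unrootClass ∘ mkCM`. [folklore] -/
def unrootClass (c : CurveClass ℂ) : UnbasedLoop ℂ := by
  classical
  exact if h : c.IsLoop then UnbasedLoop.mk (BasedLoop.mk c h)
    else UnbasedLoop.mk (BasedLoop.mk (CurveClass.mk (Curve.const c.source)) rfl)

/-- **`unrootCM` factors through the class of the path.** [folklore] -/
theorem unrootCM_eq_unrootClass (γ : C(I, ℂ)) : unrootCM γ = unrootClass (mkCM γ) := by
  by_cases h : γ 0 = γ 1
  · rw [unrootCM, dif_pos h, unrootClass, dif_pos (show (mkCM γ).IsLoop from h)]; rfl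
  · rw [unrootCM, dif_neg h, unrootClass, dif_neg (show ¬ (mkCM γ).IsLoop from h)]; rfl

/-- Paths with the same class have the same unbased loop. [folklore] -/
theorem unrootCM_congr {γ γ' : C(I, ℂ)} (h : mkCM γ = mkCM γ') : unrootCM γ = unrootCM γ' := by
  rw [unrootCM_eq_unrootClass, unrootCM_eq_unrootClass, h]

/-- `unrootClass` is `1`-Lipschitz on loop classes. [folklore] -/
theorem dist_unrootClass_le_of_isLoop {c c' : CurveClass ℂ} (hc : c.IsLoop) (hc' : c'.IsLoop) :
    dist (unrootClass c) (unrootClass c') ≤ dist c c' := by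
  rw [unrootClass, dif_pos hc, unrootClass, dif_pos hc', UnbasedLoop.dist_mk_mk]
  exact BasedLoop.dist_le_dist_toCurveClass _ _

/-- `unrootClass` is `1`-Lipschitz on non-loop classes. [folklore] -/
theorem dist_unrootClass_le_of_not_isLoop {c c' : CurveClass ℂ} (hc : ¬ c.IsLoop) (hc' : ¬ c'.IsLoop) :
    dist (unrootClass c) (unrootClass c') ≤ dist c c' := by
  rw [unrootClass, dif_neg hc, unrootClass, dif_neg hc', UnbasedLoop.dist_mk_mk]
  refine (BasedLoop.dist_le_dist_toCurveClass _ _).trans ?_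
  show dist (CurveClass.mk (Curve.const c.source)) (CurveClass.mk (Curve.const c'.source)) ≤ dist c c'
  have e : dist (CurveClass.mk (Curve.const c.source)) (CurveClass.mk (Curve.const c'.source)) =
      dist (Curve.const c.source) (Curve.const c'.source) := rfl
  rw [e]
  refine (Curve.dist_le_dist_toContinuousMap _ _).trans ?_
  have h3 : dist c.source c'.source ≤ dist c c' := by
    have := CurveClass.lipschitzWith_source.dist_le_mul c c'
    rwa [NNReal.coe_one, one_mul] at this
  refine ((ContinuousMap.dist_le dist_nonneg).2 fun _ ↦ ?_).trans h3
  exact le_of_eq rfl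

/-- `unrootClass` is measurable (continuous on the closed set of loop classes and on its
complement). [folklore] -/
theorem measurable_unrootClass : Measurable unrootClass := by
  classical
  have hL : MeasurableSet {c : CurveClass ℂ | c.IsLoop} := CurveClass.measurableSet_setOf_isLoop
  have h1 : ContinuousOn unrootClass {c : CurveClass ℂ | c.IsLoop} := by
    refine Metric.continuousOn_iff.2 fun b hb ε hε ↦ ⟨ε, hε, fun a ha hab ↦ ?_⟩
    exact lt_of_le_of_lt (dist_unrootClass_le_of_isLoop ha hb) hab
  have h2 : ContinuousOn unrootClass {c : CurveClass ℂ | c.IsLoop}ᶜ := by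
    refine Metric.continuousOn_iff.2 fun b hb ε hε ↦ ⟨ε, hε, fun a ha hab ↦ ?_⟩
    exact lt_of_le_of_lt (dist_unrootClass_le_of_not_isLoop ha hb) hab
  have h := ContinuousOn.measurable_piecewise h1 h2 hL
  rwa [Set.piecewise_same] at h

end BrownianLoop

end Literature.Probability.RandomPlanarGeometry

end
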